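import Summits.QuantumFields.YangMills.Theorems.BalabanUVNodesN06AtOpsYSectEStKnitRecordKE9XA
import Summits.QuantumFields.YangMills.Theorems.BalabanUVNodesN06CubeDirInverseAtRecord
/-!
# BalabanUVNodes ∕ N06 ([B9], `Dag.B9_main`) — ★★★ «KE₁₀X-A»: THE MEMBER-WIDE KNIT CERTIFICATE AT THE RECORD ₁₁ («KE₉X-A» ✓p822481) WITH THE SITE CUBE LETTER `O` PINNED TO
# PRINT's DIRICHLET CUBE INVERSE `G′_□(U) = (Ω₀Δ′_{a,□}(U)Ω₀)⁻¹ = GpDirY x.toKIdx □ (parKnitY x.toKIdx) (S x □) U` (node00-def-Y (Q1) road P4, ✓E `Node00.OpsYCubeDirInverse` p822940,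
# ✓F `Node00.OpsYCubeDirInverseSymm` p823140; junction side ✓`B9KnitTransporterLocalityY`; record side ✓`N06CubeDirInverseAtRecord`)
Track A of `YM-PLAN.md` (cell `pub-ymgap`, HUMAN RULING D-0062), node **N06**.  Seat `pub-ymgap-dag-n06-d` g32.

T. Bałaban, *Propagators for lattice gauge theories in a background field*, Commun. Math. Phys. **99** (1985) 389–434 [Balaban1985BackgroundPropagators] = [B9]: p. 394 L24–33
(«we consider the operator Δ′_a with Dirichlet boundary conditions on ∂Ω₀, i.e. the operator Δ′_a↾Ω₀ = Ω₀Δ′_aΩ₀ … Its inverse is denoted by G′ … They depend on the configuration U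
restricted to Ω₀»), p. 408 L35 – p. 409 L5 («a sequence {Ω_n(□)} … The operators constructed for this sequence, which we denote by G′_□(U), C_□(U), G_□(U), satisfy all the inequalities
of Theorems 3.1–3.3»), (3.87)–(3.90) p. 409, p. 410 L14–15 («Ω₀(□) ⊂ □̃⁵»), Cor. 3.6 p. 408, Thm 3.11 p. 416.

HISTORY OF THE SLOT.  ED.121 «VW» (g23) made the site cube letter of the rows-18 walk record a FREE family `O : ∀ x, cubes → SiteOpY` with four law rows `hOagr hOsym hOloc hOlocT`; the
(Q1) line (g29, 2026-08-31) settled P0 (keep `O` free) because r05's whole-torus letter `GpCubeY` (P3) is torus-GLOBAL in `U` (the withdrawn «KE₁₀X»); node00-def-Y's road P4 (FILE E,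
2026-08-31) is the print-faithful letter with CUBE LEVELS and DIRICHLET EXTERIOR, local in `U` — THIS FILE pins it.

STATEMENT DELTA w.r.t. «KE₉X-A» `…N06AtOpsYSectEStKnitRecordKE9XA.b9LeafXUR_opsYSectESt_knitRecord_KE9XA`, binder by binder:
* GONE (5): `O` (instantiated), `hOagr` (print p.394 «depend on U restricted to Ω₀» — THEOREM: ✓`B9KnitTransporterLocalityY.GpDirY_parKnitY_congr_of_agreeWalkYO`, the knit legs
  `U(Γ^{(j)}_{y,w})` read `U` on member-blocks only, [5] p.24), `hOsym` (Thm 3.11 «symmetric» — THEOREM behind unitary legs: ✓F `GpDirY_parKnitY_isSymmTr`), `hOloc`∕`hOlocT`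
  ((3.88) `h_□Δ′_aG′_□h_□ = h_□²` and its transpose — THEOREMS: ✓E `cutMulY_deltaPrimeAY_GpDirY_cutMulY` (row agreement, `supp h_□ ⊂ NearH □`) + ✓F `cutMulY_GpDirY_deltaPrimeAY_cutMulY`
  (column agreement), packaged as ✓`N06CubeDirInverseAtRecord.localInverse_laws_hTY_GpDirY`).
* NEW (6): `S : ∀ x, cubes → Finset (SiteY x.toKIdx)` (the Dirichlet exterior `Ω₀(□)`; dag-n06-c's D3 will name the placement `emb g '' mirBoxOpen …`), `hSh : supp h_□ ⊆ S x □`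
  (print: `supp h_□ ⊂ □̃ ⊂ Ω₀(□)`), `hSnear : S x □ ⊆ near x □` and `hSblk : knitReachY x.toKIdx □ (S x □) ⊆ near x □` (COVER GEOMETRY: the walk reading's domain `near □` — free, lower-bounded
  by `hnear` — contains Ω₀(□) and the member-blocks its cube-level averaging pairs read; print: all inside `□̃⁵`), `hparU : Reg335 c α₀ U → ∀ z w, parKnitY x.toKIdx U z w ∈ U(N)` (the
  knit legs' unitarity on the class — a LETTER fact about [5]'s iterated averages, REGIME-ONLY guarded like the `hOsym` row it replaces: in the tree inside the [B7] Prop-2 window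
  (`K_pl(Mα₀)L⁴ < α₀′ ≤ α_Q`, ✓`parKnitY_mem_unitary_of_reg335P`); for every unitary field it is the `mlog`-convention item «`star (mlog W) = −mlog W` for all unitary `W`», OPEN in the
  tree, node00-def-Y (Q-sym) WORD 2026-08-31), `hUnitD : (scale guard of hOloc) → ∀ □, IsUnit (padDeltaCubeY x.toKIdx □ (parKnitY x.toKIdx) (S x □) U)` (Cor. 3.6's positivity (3.36) of
  the compressed cube-sequence operator at the knit transporter on the regime — an ESTIMATE, displayed; at `U = 1` it is dag-n06-c's D3c socket ✓E `isUnit_padDeltaCubeY_one`).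
* RE-READ AT THE PINNED LETTER (same rows, `O x □ U ↦ GpDirY x.toKIdx □ (parKnitY x.toKIdx) (S x □) U`): the walk-currency tables `hMixO hOneO hmixO h36b h36H hopI` ([B9] Thm 3.7's legs and
  the (3.42) blocks of `G′_□(U)` — Cor. 3.6's «all the inequalities of Theorems 3.1–3.3», dag-n06-c's cube campaign now with a DEFINITE target operator) and the CONCLUSION's exps record
  `expsYOfRecordV3Par … H O near …` (node00-def-Y W2) — the certificate's object is print's random-walk expansion at print's cube letters.
* EVERY OTHER BINDER BYTE-IDENTICAL to «KE₉X-A» (diff oracle: the tree file; generator `mk10.py` over its bytes; HOME twin `pub-ymgap-dag-n06-d/lean/g32/k10a/`).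
PROOF.  ONE named-argument application of the tree theorem with `(O := fun x □ => GpDirY …)` and the four law rows supplied by `N06CubeDirInverseAtRecord`.
LEFT DISPLAYED (classes, honest): `hUnitD` (Cor. 3.6 positivity), `hparU` (legs' unitarity), the cover geometry `hSh hSnear hSblk`; the (3.42)–(3.47) walk-currency tables at `G′_□(U)` and
their bond twins at the generic `OcA ΔaA RfA RtA SFA`; `hΔAKn h348n` (inner-corner members, OPEN — №524 label); Thm 3.14's data; the (3.185) record `hE`; regime bridges (by design);
equation pins; numerics (✓«ZK₅» — unchanged: no numeric row moves).
HONEST FRAMING.  Kernel bookkeeping over LANDED modules (one theorem, 0 `def`, 0 `sorry`, standard axioms); an instantiation + four by-name folds, NOT a new estimate; COUNT-NEUTRAL helper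
(`--supports stmt-QuantumFields-27239 --as helper`); N06 NOT discharged; K1ᴬ NOT closed; one finite 𝕋⁴ programme at fixed `ε` — NOT continuum ∕ OS ∕ mass gap ∕ Clay; the Yang–Mills
mass gap is NOT proved by any of this.  Inherited module texts («KE₉X-A» … «KA») are in the tree files.
-/
noncomputable section
namespace Summit.QuantumFields.YangMills.BalabanUVNodes.N06AtOpsYSectEStKnitRecordKE10XA
open Literature.MathematicalPhysics.QuantumFieldTheory.Balaban1983to89 open T4Continuum (T4Family) open Node00 open B9PinMembersKLevelV1 (MemberY geo9Y bg9Y) open B9PinGeometryKLevelV1 (dOmegaY OmKY inΛY unitDistY c35Y) open B7Prop2SpecialUnitary (specialUnitaryUnits specialUnitaryUnits_le_unitaryUnits) open B9Ineq347GAAtLetters (hGA_opsYOfLetters) open B9Ineq344LocalPairHolds (hGp_opsYOfLetters_holds) open B9Cor35ComparisonsGAAtLetters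
 (hGA_e_opsYOfLetters hGA_h1_opsYOfLetters hGA_e4_opsYOfLetters hGA_h2_opsYOfLetters hGA_l2_opsYOfLetters) open B9CoReadingCoordsHolderAdm (holderProbesKA bond_h1ReadsNbr_of_pinsA) open B9CoReadingCoordsHolderAdmReadings (bond_coReadsHHolderNbr_of_pinsA bond_inputReadsFam_of_pinsA) open B9CoReadingCoordsHolderSNear (holderProbesSN site_h1ReadsNbr_of_pinsSN) open B9CoReadingCoordsHolderSNearReadings (site_inputReadsFam_of_pinsSN) open N06DirKinematicsAtPinsR (h36HA_of_dir_pinsR h36_of_dirSq_pinsR h36A_of_dirSq_pinsR) open N06DirKinematics3AtPinsSNO (h36H_of_dir_pins₃SN_of_transpose) open Node00.OpsYSectDCoords (TpicoK T2coK RcoK) open Node00.OpsYOps312OfRecordPar (S0coKq QcoKHq QscoKHq CcoKq C1coKq) open B9CoReadingCoordsH (blkHK HcoK) open Node00.OpsYQLetter (qKnitOfRecord qsKnitOfRecord regQY) open B9B8AveragingJunction (parKnitY) open B9B8KnitLetterGpDecay (symm0_parKnitY) open B9PinGeometryKLevelV1 (c35Y_eq) open B9C2FormBoxRegimeY (Kpl)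 open B6KLevelCensusIndexV1 (kGeo) open N06WalkLettersAtRecordROPar (laws_parKnitY_of_reg335P identities₂_opsWalkYO_of_reg335R_laws) open B9Thm311ReadingCoords (PosDefTr) open B9LeafXCodedKnitUParH (b9LeafX_carriersYUParH) open B9LeafXCodedKnitUParHX (b9LeafX_carriersYUParHX Y9OfRecordUPbParHX carriersYUParHX) open B9SectBCodedClassKnitY (C37KY) open Node00 (carriersYUParH Y9OfRecordUPbParH kernelFamilyS kernelFamilyB cqY GAQY GpY parBY CY opsYSectESt deltaAQY siteKernelOfOp) open B9SectBCodedReadingsUParH (SectBStepUPar) open B9SectBKerFrameCodedYR (CinvY) open B9SectBCodedClassGY (C37GY) open Node00 (opsYS349NuOfLettersH parSymY_one) open Node00.OpsYExpsOfRecordV3Par (expsYOfRecordV3Par) open B9Thm39FacesAtLettersRCPar (t39_hksum_oneCube_opsYOfLetters_FRC_par) open B9Thm39OneCubeReadingAtLettersY (oneCubeOps39) open B9Thm39ReadingAtLetters (L39) open B9Ineq349SiteFromConv348 (blk39F) open B9Thm311ReadingAtLettersQ (t311_of_pins_opsYOfLettersRQ inputs311YQ_of_laws) open B9BackgroundsKLevelV1R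 (kernelFamilyRY hKernelRY siteKernelR) open B9Thm315SectEStarRepAtLettersR (t315_opsYSectESt_sectEStYOfRecordV7_of_3185_onR) open Node00.OpsYExpsOfRecordV3 (expsYOfRecordV3) open B9WalkLettersOpsO (opsWalkYO dirOpsWalkYO dirLettersWalkYO rdWalkYO agreeWalkYO staticOK_opsWalkYO) open N06WalkLettersAtRecordRO (localityDir_opsWalkYO_of_agree identities₂_opsWalkYO_of_reg335R) open B9Local342AtOpsWalkYO (local342_opsWalkYO_of_blocks) open B9Thm37CubeCoverCommutators (cutMulY hTY) open Node00 (SiteY SiteOpY deltaPrimeAY) open B9WalkLettersOps (nearDomY) open B9Thm37KLetterDir (FactorsL2Mixed37Dir) open B9H43GpFromPinsSN (h43Gp_of_thm37PrintedSN) open B9HpDGWFromPinsSN (hpDGW_of_thm37PrintedSN_unif) open B9H44GFromPinsSN (h44G_hp45W_of_thm37PrintedSN) open B9H44mFromPinsKA (h44m_h45X_h45Y_of_local3107 thm33G0DirT_of_local3107 inputConst44_pins_nonneg inputConst45_pins_nonneg const37_pins_nonneg) open B9SmoothHolderClassPI (bHZPIfam bHZKPIfam) open B9RWSums347DefiniteFaces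 (exp261) open B9RWSums344Input (inputConst44 inputConst45) open B9RWSums343Holder (holderConst) open B9Thm37Whole (const37)  open N06CurrentMajAtPinsIdPhys (hBJ_of_pins_P) open B9WalkLettersOps (opsWalkY dirOpsWalkY dirLettersWalkY kappaWalkY thetaWalkY KcWalkY rdWalkY) open B9WalkLettersOpsFacts (staticOK_opsWalkY bounded_kappaWalkY) open N06WalkLettersAtRecordR (localityDir_opsWalkY_of_agree identities₂_opsWalkY_of_reg335R)  open N06DgLegAtPinsPhysPU (hκ13_of_pinsP dgDH_dgDHd_of_pinsP_geo9Y) open B9SmoothHolderClassP (bHZPG bHZKP bHZKPG) open N06WELegAtPinsPhysPUB (hκX_of_pinsP hWE_of_pinsP_geo9Y_budget) open N06WGpLegAtPinsPhysPU (hwGp_of_pinsP_geo9Y) open N06RgdH43LegAtPinsPhysPU (hrgdH_of_pinsP43_geo9Y) open B9SmoothHolderClassPProducers (CTel) open B9Ineq349SiteThresholdRateNamed (thrM349 cg349 cg349_pos fineEntryS_le_named) open B9Thm39ReadingAtLetters (basis39 κ39) open B9MultiscaleSmoothPartitionYNear (rNear) open B9Thm313WholeDvHolderAtPinsGraded (thetaL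 CJG) open B9PlaquetteBinderOfReg335Y (plaqV_binder_of_regYR_budget_SU budget_nonneg) open B9SectDSup (weightNorm) open B9MultiscaleSmoothPartitionYLip (CLip) open B9GradViaDivLettersTransported (taxiS taxiB) open B9OpsRTransport (ops312RY) open B9Ineq349SiteFacesAtLettersR (s349_site_of_t37_display348_of_R) open B9Thm314Thm315LayerR (thm314_pair_layerOfLettersR) open B9Eq335ClassBridgePV1 (regY335_of_regYP335 regY336_of_regYP336) open B9BackgroundsKLevelV1P (bg9YP)  open N06MixedFactorAtPinsPhysR (h36H_of_mixedFactorR) open B9RWSums346MixedFactorOfLegsY (factorsL2Mixed37Dir_of_legs MLeg BLeg) open N06SplitMajorantsAtPinsPhysR (split_majorants_of_letter_schemasR) open N06Thm312313AtPinsStateSUCLE (t312_t313_of_pins_stateSUCLE) open B9Thm313WholeLeafCompletePairMBCZcUSXCL (letters313L2Pc_of_fields) open N06Rgd2LegAtPinsPhysPU (hrgd2_of_pinsP_geo9Y) open B9SectBStepUClosedSUOfSections (sectBStepU_C37GY_su_extraYPb_closed) open Node00.OpsYExpsOfRecordV2 (expsYOfRecordV2) open Node00.OpsYOps312OfRecord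 (ops312YOfRecord) open Node00.OpsYBondMapOfRecord (bIYOfRecord) open N06G0QstarLettersLegAtPinsPU (g0qstar_letters_of_pins)  open B9Thm39FacesAtLettersRC (t39_hksum_oneCube_opsYOfLetters_FRC) open B9Thm311Thm315FacesAtLettersR (t311_of_pins_opsYOfLettersR) open B9Thm315SectEStarRepAtLettersR (DecayMidOnStY t315_opsYNuStOfRecordV4PE_sectEStYOfRecordV7_of_3185_onR) open B9BackgroundsKLevelV1R (RegFamY MemOfFam mem_of_reg335R bg9YR regYP335 regYP336 regYP335_one kernelFamilyR hKernelR rwExpansionR fineKernelR) open B9LeafXClassAntitone (ClassIncl residualGpAtOne_R residualGAGlobAtOne_R rwSumsYieldIneqs_R rwKernelSumYields_R thm37Printed_antitone cor38Printed_antitone thm39Printed_antitone thm310Printed_antitone thm311Printed_antitone thm312Printed_antitone thm313Printed_antitone thm314Printed_antitone thm315FullPrinted_antitone stmt349Printed_antitone stmt3132Printed_antitone thm314LocalPrinted_antitone) open B9PinGeometryKLevelV1B (c35B ten_L3_le_c35B ten_L4_le_c35B c35Y_le_ten) open DagBinding (B9LeafX) open N06Ids3152AtPinsPhys (ids3124_ids3152_of_hZ_pins)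 open Node00.OpsYNablaBridge (cf_mul_etaS_of_hcfk)
open B9Cor35ComparisonsGpCAtLetters (hGp_e_opsYOfLetters hGp_h1_opsYOfLetters hC_opsYOfLetters) open B9Cor35ComparisonsEH (hE4_of_hGA_e4 hH2_of_hGA_h2) open B9GeoLemma21KLevelV1 (geo9Y_len_pos) open B9Thm39WholeBlk (Conv348Blk) open B9Thm39OneCubeReadingAtLettersY (oneCubeOps39YF) open B9RowSum261DefiniteFaces (rowConst261) open B9Thm312Whole (GeoOK FormSmall cNorm PosDefEnd) open B11SectG (BlockNorm HasMaj) open B9GeoNormsKLevelV1 (geo9K_dist_nonneg geo9K_supNorm_nonneg) open B9GeoLemma21KLevelV1 (geo9Y_dist_triangle geo9Y_dist_comm) open B9GeoNormsKLevelModelSignsV1 (modelSignsOn_geo9K) open B9Thm34Ext (toB6) open B9CoRealizesRelAtLetters (RelB maj342_relB_left maj342_relB_right dist_eq_of_relB len_eq_of_relB relB_refl) open B9SectCDiffDict (maj342) open B6Ineq2142KLevelV1 (β) open B9CarrierBlockMultiplicity (card_sameCarrier_le_kIdx) open B9Thm311ReadingCoords (PosDefTr) open B9PinGeometryKLevelV1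 (kLab) open B9Thm314GpFlatTorusGeometry (tdistK OmegaC) open B9Thm314WholePinGeometry (locDataY) open B9Thm314WholePair (locData₂) open B9Thm314WholePairWalks (pairWalkSets) open B9Thm314WholeSummation (WalkSetsSpec WalkWeightsSummable) open B9SectCWalkTermsAllNorms (Thm310AllNormsPrinted) open B9Thm314WholeExpansionReads (ExpansionReads) open B9Thm314WholeCancellationLayer (pairOp) open B9Thm37Whole (Ops Sizes StaticOK Local342)
open B9Cor38Whole (WalkReading) open B9C2FormMajTorusLettersAtMemberY (c2FormMaj_c2YOfRecord_of_hβ1) open B7Prop2Explicit (C0 c2') open B7Prop3Flat (c3) open B7Prop5GeneralLevels (C3Gen thetaGen) open B6RandomWalk (HasMajorant) open Node00.OpsYLocalInverse (GsqY) open B9BlockKeyTransferXBK (local342G_of_blocks_idxPins) open B6GlobalChartV1 (blkV1) open B9GeoNbrCountBlocksY (nbrM₀BY nbrCountBY hnbrBY_real_of_le) open B9Local342MonoConst (local342_mono_const local342G_mono_const) open B9SectBAllBlocksGeometryY (geoBY) open Node00.OpsYBlockPinOfRecord (blkOfSK dist_beta_blkSK_sIK_bIYOfRecord_le_one len_blkSK_sIK_bIYOfRecord_eq)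 open B6Geom246MultiLevelBox (blkOf) open B9Eq352DivFormLetters (conj) open B9Eq352GradLetters (diffLetter) open B9Thm310Whole (Ops310 WalkReading310 Sizes310 StaticOK310 Locality310 Local342G) open B9Thm310WholeDir (DirLetters310 Identities310₂) open B9RWSumsDefinitePins (PinPrims) open B9RWSumsDefinitePinsPair (PairPrims) open B9RWSumsDefinitePinsPairM (MixedPrims E310YPairM) open B9RWSumsDefinitePinsPairMDir (E37YPairMDir) open B9RWSumsDefinitePinsPairMDir4Rows (rows131819_definite_geo9Y_pairM_dir₄) open B9Thm37WholeDir (DirLetters37 Identities₂) open B9Cor38WholeDir (LocalityDir) open B9Thm37KLetterDir (HolderV37Dir FactorsInputPair37Dir) open B9RWSums344InputFam (InputReadsFam sliceProbe) open B9RWSums344InputPair (InputLegsPair37 InputLegsPair310 FactorsInputPair310) open B9RWSums346MixedPair (L2MixedLegs310 FactorsL2Mixed310 L2MixedLegs37) open B9CoReadingCoordsTranspose (TrIdx trBasis isTransposePair_GcoK_trBasis isTransposePair_DcoK_GcoK_trBasis isTransposePair_GcoS_trBasis isTransposePair_DcoS_GcoS_trBasis) open B9Thm311SymmAtRecordV4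 (symm0_parSymY symmG_parSymY) open B9Thm311AdjointPairs (GpY_isSymmTr) open B9RWSums346SecondDiff (familyOp DirOps310 L2SecondLegs310) open B9RWSums346SecondDiffGp (DirOps37 L2SecondLegs37) open B9Thm37Glue (IsTransposePair) open B9RWSumsReadsNbr (H1ReadsNbr) open B9RWSums346Two (L2TwoLegs310 FactorsL2_310) open B9RWSums343Holder (HolderProbes HolderLegs310 FactorsHolder310) open B9RWSums343HolderGp (HolderLegs37) open B9Thm39ReadingCoords (cR39) open B9CoReadingCoords (XBK evBK blkBK GcoK DcoK DscoK LcoK coordOpK cdBₗ cdsBₗ) open B9CoReadingCoordsS (XSK evSK blkSK sIK sIK_faithful off_bound_evSK GcoS DcoS DscoS LcoS) open B9CoReadingCoordsL2S (sIK_dist_le_one site_l2ReadsNbr012_of_pins site_l2ReadsNbr345_of_pins) open B9CoReadingCoordsL2Pair (bond_l2ReadsNbr345_of_pins) open B9Ineq349SiteComposite (cdSL cdsSL) open B9Thm312WholeHHolderNbr (CoReadsHHolderNbr) open B9Thm311ReadingCoords (IsSymmTr) open N06CoReadingsOfPins (bond_coReadings3_of_pins bond_coReadingsLap_of_pins site_coReadings4_of_pins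 bond_l2ReadsNbr3_of_pins) open B9GeoNbrCountKLevelV1 (nbrM₀Y nbrCountY hnbr_two_of_le) open B9CoReadingCoordsH (XHK) open B6Ineq2142KLevelV1 (lvl) open B9Thm314WholePinGeometry (locDataY_laws) open B9PinGeometryKLevelV1 (dOmegaY_nonneg) open scoped Matrix.Norms.L2Operator
open N06Proj349AtPinsPhysRC (proj349Maj_of_t37_display348_rateR_ge cP349_nonneg) open B9Eq346GradGpDivAtPinsL2Closed (M46 a46 B46 δ46 M46_pos a46_pos B46_pos blockBd_DvGcoSDvs_memberY_at) open B9PerturbationL2Delta2 (D2coK constL2Pi constL2Pi_nonneg) open B9PerturbationL2Letters (constL2 constL2_nonneg) open N06SectDUnitsAtPinsPhys (isUnit_deltaPiAY_of_formSmall_phys isUnit_deltaOneY_of_formSmall_phys posDefEnd_S0coK_of_posDefTr_phys posDefTr_deltaOneY_of_formSmall_pins_phys identitiesDef_of_pins_phys isUnit_deltaAY_phys_of_posDefTr) open B9Thm313WholeLettersCut (Letters313HZc Letters313L2Pc) open B9Thm313WholeRgdFrom3152 (Ids3152) open B9SectDSup (weightNorm) open B9Thm313WholeLeftZ (Letters313DZ)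 open B9Thm313WholeDirZ (Letters313DMZ) open B9Thm313WholeHolderZ (Letters313HZ) open B9LettersHZAtOne (plateau_pos) open B9Thm312WholeClasses (cNormR) open B9CoReadingCoordsHolder (PK) open B9CoReadingCoordsInput (bHK) open B9CoReadingCoordsInputS (bHS) open N06G0QstarL2LettersLegAtPinsPU (g0qstar_l2_letters_of_pins)  open N06RgdILegAtPinsPhysR (rgdI_of_pinsR) open N06RgdDsLegAtPinsPhysR (rgdDs_rgdDd_of_pinsR) open N06DivLegAtPinsPhysR (hdivDs_of_pinsR) open N06HHLegAtPinsPhysRU (hLHH_of_pinsRU) open N06CutL2LettersAtPinsPhysR (vDRDG_vGDRD_of_pinsR) open N06MixedLegAtPinsPhys (hcntM_of_walkCnt) open N06Row17FromRow19LettersDir (row17_of_row19_letters₂) open B9WalkLettersCoordsS (SblkY hWalkY gsqcoS walkCntM₀Y walkCntY nearBlkCntY cubeDomY) open B6Cover236MultiLevelBlocks (cubes)  open B9Thm39ReadingCoords (coordBound39 basisBound39) open B9Thm31GpMajFromPinsPairMR (thm31GpMaj_of_t37_pairMR) open B9PerturbationMajorantLetters (const3131) open B9RowSum261DefiniteFaces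 (rowConst261) open B9Thm312WholeIdentitiesSplit (Ids3124 identities_of_def_3124) open Node00.OpsYSectDCoords (DvcoKH DvscoKH GcoK_GAY_mul_S0coK cR39_trBasis_pos) open B9Thm311ReadingCoords (isUnit_of_posDefTr) open N06Level13D2Rgdd13LayerAtPinsPUW (level13_d2_rgdd13_layer_of_pinsP_geo9Y) open N06G0CoreFromThm310GUSPC (g0_core_of_thm310_coreDir₃USP) open N06StepL2AtPinsPhysR (blockBd_tpi_of_letter_schemasR) open B9Delta2FormMajorant (C2FormMaj) open B9GradLetterTransportedInputClassesPI (bHZPIfam_κ exists_l1_control_bHZPIfam) open B9MultiscaleSmoothPartitionYNear (rNear) open B9RWSumsDefinitePins (PinPrims.rate_pos) open B9Eq3132FromStateR (s3132Nu_opsYSectE_of_stepS_R_of_refinesY) open B9StateAprioriL1 (exists_l1_control_bHK exists_l1_control_bHS) open B9MultiscaleSmoothPartitionYLip (CLip_nonneg) open B9Thm312WholeClasses (rwt rwt_nonneg)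
open B9LeafXCodedKnitU (b9LeafX_carriersYU) open B9SectBCodedClassR (regC335 regC336 bg9YC extraYPb classIncl_regC335Pb_regYPb335 classIncl_regC336Pb_regYPb336 classIncl_regYPb335_regC335Pb) open Node00 (Y9OfRecordUPb carriersYU CfgY BlkY IBondY deltaAY) open B9Eq360DeltaPrimeAY (AfldY) open B9PinMembersKLevelV1 (mstar_le_M) open B9LettersZSchemasMono (kernel_mono letters313DMZ_mono)
variable {N : ℕ}
section Pointed
variable [NeZero N] [Nonempty (Fin N)] {F : T4Family}
open Summit.QuantumFields.YangMills.BalabanUVNodes.N06AtOpsYSectEStKnitSectDKDR (t312_t313_opsYSectESt_knit_KDR)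
open Literature.MathematicalPhysics.QuantumFieldTheory.Balaban1983to89.B9Delta2FormMajorant (C2FormMaj) open Literature.MathematicalPhysics.QuantumFieldTheory.Balaban1983to89.Node00 (C2Y delta2OfQY trDualMatY GpPhysY) open Literature.MathematicalPhysics.QuantumFieldTheory.Balaban1983to89.B6RandomWalkHom (HasMajorantHom) open Literature.MathematicalPhysics.QuantumFieldTheory.Balaban1983to89.Node00.OpsYOps312OfRecordPar (QcoKHq) open Literature.MathematicalPhysics.QuantumFieldTheory.Balaban1983to89.B9Eq3115KnitLetterYOnto (kCol) open Literature.MathematicalPhysics.QuantumFieldTheory.Balaban1983to89.B9Eq316AveragingTransposeZd (alphaQ) open Literature.MathematicalPhysics.QuantumFieldTheory.Balaban1983to89.B9GeoNbrCountKLevelV1 (nbrM₀Y) open Literature.MathematicalPhysics.QuantumFieldTheory.Balaban1983to89.B9Eq3132TentBumps (Cth) open Literature.MathematicalPhysics.QuantumFieldTheory.Balaban1983to89.B9CoReadingCoordsH (blkHK) open Literature.MathematicalPhysics.QuantumFieldTheory.Balaban1983to89.Node00.OpsYQLetter (qKnitOfRecord qsKnitOfRecord)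
open Summit.QuantumFields.YangMills.BalabanUVNodes.N06AtOpsYSectEStKnitPairKCXS (b9LeafXUR_opsYSectESt_knit_pairKCXS)
open Summit.QuantumFields.YangMills.BalabanUVNodes.N06AtOpsYSectEStKnitRecordKE7X (b9LeafXUR_opsYSectESt_knitRecord_KE7X)
open Summit.QuantumFields.YangMills.BalabanUVNodes.N06AtOpsYSectEStKnitRecordKE8X (b9LeafXUR_opsYSectESt_knitRecord_KE8X)
open Literature.MathematicalPhysics.QuantumFieldTheory.Balaban1983to89.B9Eq316AveragingTransposeZd (alphaQ)
open Literature.MathematicalPhysics.QuantumFieldTheory.Balaban1983to89.B9Eq3115KnitLetterYOnto (kCol)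
open Literature.MathematicalPhysics.QuantumFieldTheory.Balaban1983to89.Node00 (resYOfRecordPK)
open Literature.MathematicalPhysics.QuantumFieldTheory.Balaban1983to89.Node00.OpsYBondMapOfRecord (lawsY_of_eq)
open Literature.MathematicalPhysics.QuantumFieldTheory.Balaban1983to89.B9PinGeometryKLevelV1 (c35Y_eq)
open Literature.MathematicalPhysics.QuantumFieldTheory.Balaban1983to89.B9WalkLettersOps310 (hWalkBY ops310WalkYO dirOps310WalkYO dirLetters310WalkYO kappa310WalkY agree310WalkYO rd310WalkYO)
open Literature.MathematicalPhysics.QuantumFieldTheory.Balaban1983to89.B9WalkLettersOps310Facts (staticOK310_ops310WalkYO bounded_kappa310WalkY okRel_rd310WalkYO locality310_ops310WalkYO)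
open Literature.MathematicalPhysics.QuantumFieldTheory.Balaban1983to89.B9CoReadingCoords (XBK GcoK)
open Summit.QuantumFields.YangMills.BalabanUVNodes.N06AtOpsYSectEStKnitRecordKE9XA (b9LeafXUR_opsYSectESt_knitRecord_KE9XA)
open Literature.MathematicalPhysics.QuantumFieldTheory.Balaban1983to89.Node00.OpsYCubeDirInverse (GpDirY padDeltaCubeY)
open Literature.MathematicalPhysics.QuantumFieldTheory.Balaban1983to89.B9KnitTransporterLocalityY (knitReachY)
open Literature.MathematicalPhysics.QuantumFieldTheory.Balaban1983to89.B7Prop2Explicit (unitaryUnits)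
open Summit.QuantumFields.YangMills.BalabanUVNodes (N06CubeDirInverseAtRecord.hOagr_GpDirY_of_agreeWalkYO N06CubeDirInverseAtRecord.hOsym_GpDirY_of_unitaryLegs N06CubeDirInverseAtRecord.localInverse_laws_hTY_GpDirY)
set_option maxHeartbeats 2400000 in set_option synthInstance.maxSize 2048 in set_option maxRecDepth 8192 in
/-- ★★★ **THE MEMBER-WIDE KNIT CERTIFICATE AT THE RECORD ₁₁ («KE₉X-A»: rows 15∕16∕17 consumed at section-carrying members, displayed at inner-corner members; rows-19 bond walk letters instantiated) WITH THE SITE CUBE LETTER PINNED TO PRINT's `G′_□(U) = (Ω₀Δ′_{a,□}(U)Ω₀)⁻¹`** («KE10XA», node00-def-Y (Q1) road P4):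
✓«KE9XA» `…KnitRecordKE9XA.b9LeafXUR_opsYSectESt_knitRecord_KE9XA` with `O := fun x □ => GpDirY x.toKIdx □ (parKnitY x.toKIdx) (S x □)` (✓E `Node00.OpsYCubeDirInverse`, the Dirichlet cube inverse at the
member's field and the KNIT transporter, Dirichlet exterior `S x □ = Ω₀(□)` a binder): `hOloc`∕`hOlocT` ((3.87)–(3.88) and its transpose at `h_□`) are THEOREMS (E's row law, F's column law —
`N06CubeDirInverseAtRecord.localInverse_laws_hTY_GpDirY`) from `hSh : supp h_□ ⊆ S □` and the displayed positivity `hUnitD`; `hOagr` (print p.394 «depend on U restricted to Ω₀») is a THEOREM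
(✓`B9KnitTransporterLocalityY.GpDirY_parKnitY_congr_of_agreeWalkYO`: the knit legs read `U` on member-blocks only) from the displayed cover geometry `hSnear hSblk`; `hOsym` (Thm 3.11 «symmetric») is a
THEOREM (✓F `GpDirY_parKnitY_isSymmTr`) behind the displayed letter fact `hparU` (knit legs `U(N)`-valued on the class).  NEW displayed: `S hSh hSnear hSblk hparU hUnitD` (6); GONE: `O hOagr hOsym hOloc hOlocT` (5);
RE-READ AT THE PINNED LETTER (same rows): the walk-currency tables `hMixO hOneO hmixO h36b h36H hopI` of [B9] Thm 3.7 ∕ Cor. 3.6 for `G′_□(U)` and the conclusion's exps record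
`expsYOfRecordV3Par … H O near …` — now statements about a DEFINITE operator; every other binder byte-identical.  PROOF: ONE named application of the tree theorem.
[cite: Balaban1985BackgroundPropagators, p.394 L24–33, p.408 l.35–p.409 l.5, (3.87)–(3.90) p.409, p.410 L14–15, Cor. 3.6 p.408, Thm 3.11 p.416, Thms 3.7–3.15 pp.409–432; Balaban1984PropagatorsII, (2.36)–(2.46) pp.229–231; Balaban1985Averaging, p.24, Prop. 2 p.26] -/
theorem b9LeafXUR_opsYSectESt_knitRecord_KE10XA
    (θ : Stage11Params F N) (hθ : θ.Admissible) (Mstar : ℕ)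
    -- [CASCADE-K K3] THE FOUR LETTER PINS (node00-def-Y's knit record `lettersYOfRecordV11K` closes them by `rfl`): bond transporter `parBY` and the three composites over print's KNIT averaging contours `parKnitY` and print's `Q` of (3.115): `G′ = GpY parKnitY`, `G = G[Qknit](parKnitY, G′)`, `C = (Q′G′²Q′*)⁻¹(parKnitY, G′)`; the HÖLDER transporter of (3.40) is `parSymY`, entering at the `G′` slot of the object (`opsYS349NuOfLettersH … (fun x => parSymY x.toKIdx)`), in the Hölder probes `𝔭` and in Thm 3.7's residual family (node00-def-Y's ruling, 2026-08-30)
    (𝔢₀ : SectEY N θ.toStage3Params Mstar) (𝔴 : RWEY N θ.toStage3Params Mstar) (𝔈₀ : ExpsY N θ.toStage3Params Mstar) {R₁ R₂ : RegFamY θ.d₆ θ.ℓ₆ θ.hd' θ.hL' θ.b₀ θ.b₁ Mstar (Matrix (Fin N) (Fin N) ℂ)} (c : ℝ) (hcB : c35B θ.ℓ₆ ≤ c) (hc : 0 < c) (hGR : MemOfFam (specialUnitaryUnits (Fin N)) R₁) (hRP1 : ∀ (x : MemberY θ.d₆ θ.ℓ₆ θ.hd' θ.hL' θ.b₀ θ.b₁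 Mstar) (α₀ : ℝ) (U : (bg9YR (Matrix (Fin N) (Fin N) ℂ) (specialUnitaryUnits (Fin N)) R₁ R₂ x).Cfg), (bg9YR (Matrix (Fin N) (Fin N) ℂ) (specialUnitaryUnits (Fin N)) R₁ R₂ x).Reg335 c α₀ U → 0 ≤ α₀ ∧ (bg9YP (Matrix (Fin N) (Fin N) ℂ) (specialUnitaryUnits (Fin N)) x).Reg335 c35Y α₀ U) (hP1 : ClassIncl (regYP335 (Matrix (Fin N) (Fin N) ℂ) (specialUnitaryUnits (Fin N))) c35Y R₁ c) (hP2 : ClassIncl (regYP336 (Matrix (Fin N) (Fin N) ℂ) (specialUnitaryUnits (Fin N))) c35Y R₂ c) [∀ x : MemberY θ.d₆ θ.ℓ₆ θ.hd' θ.hL' θ.b₀ θ.b₁ Mstar, Fintype (geo9Y x).Site] [∀ x : MemberY θ.d₆ θ.ℓ₆ θ.hd' θ.hL' θ.b₀ θ.b₁ Mstar, DecidableEq (geo9Y x).Site] [∀ x : MemberY θ.d₆ θ.ℓ₆ θ.hd' θ.hL' θ.b₀ θ.b₁ Mstar, Fintype (geoBY x).Site] [∀ x : MemberY θ.d₆ θ.ℓ₆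 θ.hd' θ.hL' θ.b₀ θ.b₁ Mstar, DecidableRel (RelB x.toKIdx)] (bI : ∀ x : MemberY θ.d₆ θ.ℓ₆ θ.hd' θ.hL' θ.b₀ θ.b₁ Mstar, FBondY x.toKIdx → IBondY x.toKIdx) (hbI : bI = bIYOfRecord θ.toStage3Params Mstar) (α' r39 δ39 B39 a39 : ℝ) (hα'0 : 0 < α') (hα'1 : α' < 1) (hr39 : 0 < r39) (hrδ39 : r39 ≤ δ39) (hB39 : 0 < B39) (ha39 : 0 < a39) -- gen 29 «KE₉X»: ROWS 15∕16 CONSUMED at every SECTION-CARRYING member (dag-n06-j ✓p813179, named (3.48) constants `knit348M₁ a₁ B₀ δ₀`); `M39 := knit348M₁ …`;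
    -- three x-free comparison numerics + the ONLY rows-15∕16 display left: at the NON-section-carrying members (`β` not onto = an inner corner; print's (2.1)–(2.4)∕(4) do NOT exclude them — (3.48) there is OPEN in the tree)
    (ha39K : c35Y * a39 ≤ c * B9Thm32KnitRows1516ThresholdsY.knit348a₁ N θ.toStage3Params Mstar) (hB39K : B9Thm32KnitRows1516ThresholdsY.knit348B₀ N θ.toStage3Params Mstar ≤ B39) (hδ39K : δ39 ≤ B9Thm32KnitRows1516ThresholdsY.knit348δ₀ N θ.toStage3Params Mstar) (h348n : ∀ x : MemberY θ.d₆ θ.ℓ₆ θ.hd' θ.hL' θ.b₀ θ.b₁ Mstar, ¬ Function.Surjective (β x.hN x.D x.hk) → B9Thm32KnitRows1516ThresholdsY.knit348M₁ N θ.toStage3Params Mstar ≤ (geo9Y x).M → ∀ α₀ : ℝ, 0 < α₀ → c * (geo9Y x).M * α₀ ≤ a39 → ∀ U : (bg9YR (Matrix (Fin N) (Fin N) ℂ) (specialUnitaryUnits (Fin N)) R₁ R₂ x).Cfg, (bg9YR (Matrix (Fin N) (Fin N) ℂ) (specialUnitaryUnits (Fin N)) R₁ R₂ x).Reg335 c α₀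 U → Conv348Blk (oneCubeOps39 (geo9Y x) (bg9YR (Matrix (Fin N) (Fin N) ℂ) (specialUnitaryUnits (Fin N)) R₁ R₂ x) (blk39F (Matrix (Fin N) (Fin N) ℂ) x.toKIdx (bI x)) (L39 x.toKIdx (parKnitY x.toKIdx) (lettersYOfRecordV11K N θ.toStage3Params Mstar (resYOfRecordPK N θ.toStage3Params Mstar) x).Gp)) B39 δ39 U) {AA : MemberY θ.d₆ θ.ℓ₆ θ.hd' θ.hL' θ.b₀ θ.b₁ Mstar → Type} [∀ x, Fintype (AA x)] (p q : PinPrims) (hp : p.OK) (hq : q.OK)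
    -- [CASCADE-K K3] THE KNIT-LETTER NUMERICS (x-free; dag-n06-l `knitWindow_inhabited_le`): window `α₀K` with `C₀α₀K ≤ 1/3`, `2α₀K ≤ c₂′`, the plaquette threshold `aK` (`K_pl(a)·L⁴ < α₀K` for `0 ≤ a ≤ aK`) and the two regime thresholds read against it; they DERIVE the knit legs' unitarity + `Δ′_a(U; parKnitY) > 0` (K2 laws `laws_parKnitY_of_reg335P`) and `G_a`'s symmetry
    (α₀K aK : ℝ) (hαK : 0 < α₀K) (hαK3 : C0 (θ.d₆ + 1) * α₀K ≤ 1 / 3) (hαK2 : 2 * α₀K ≤ c2' (θ.d₆ + 1) (θ.ℓ₆ + 1)) (hKplK : ∀ (i : B6KLevelCensusIndexV1.KIdx θ.d₆ θ.ℓ₆ θ.hd' θ.hL' θ.b₀ θ.b₁) (a : ℝ), 0 ≤ a → a ≤ aK → Kpl i a * (kGeo i).L ^ 4 < α₀K) (hpaK : p.a₁ / c ≤ aK) (hqaK : q.a₁ / c ≤ aK) (p3 q3 : PairPrims) (hp3 : p3.OK) (hq3 : q3.OK) (pM qM : MixedPrims) (hpM : pM.OK) (hqM : qM.OK) (H : MemberY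 θ.d₆ θ.ℓ₆ θ.hd' θ.hL' θ.b₀ θ.b₁ Mstar → Prop) (hM₀ : nbrM₀Y θ.d₆ θ.ℓ₆ θ.hd' θ.hL' θ.b₀ θ.b₁ 2 ≤ Mstar) (𝔭 : ∀ x : MemberY θ.d₆ θ.ℓ₆ θ.hd' θ.hL' θ.b₀ θ.b₁ Mstar, HolderProbes (geo9Y x) (bg9YR (Matrix (Fin N) (Fin N) ℂ) (specialUnitaryUnits (Fin N)) R₁ R₂ x) (XSK (TrIdx N) x.toKIdx) (XSK (TrIdx N) x.toKIdx) (PK (SiteY x.toKIdx) (Fin (θ.d₆ + 1)) (TrIdx N)) (PK (SiteY x.toKIdx) (Fin (θ.d₆ + 1)) (TrIdx N))) (h𝔭 : ∀ x : MemberY θ.d₆ θ.ℓ₆ θ.hd' θ.hL' θ.b₀ θ.b₁ Mstar, 𝔭 x = holderProbesSN x.toKIdx (trBasis N) (bg9YR (Matrix (Fin N) (Fin N) ℂ) (specialUnitaryUnits (Fin N)) R₁ R₂ x) (fun U => U) (parSymY x.toKIdx) (bI x)) (bHX : ∀ x : MemberY θ.d₆ θ.ℓ₆ θ.hd' θ.hL'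 θ.b₀ θ.b₁ Mstar, ℝ → BlockNorm (toB6 (geo9Y x) 1 (H x)) ((XSK (TrIdx N) x.toKIdx) → ℝ)) (hbHX : ∀ x : MemberY θ.d₆ θ.ℓ₆ θ.hd' θ.hL' θ.b₀ θ.b₁ Mstar, bHX x = fun ε => letI : Fintype (B9GeoNormsKLevelV1.geo9K x.toKIdx).Site := (inferInstance : Fintype (geo9Y x).Site); bHS x.toKIdx (sIK x.toKIdx (bI x)) ε) (SH S3 SI : ∀ x : MemberY θ.d₆ θ.ℓ₆ θ.hd' θ.hL' θ.b₀ θ.b₁ Mstar, ↥(cubes x.toKIdx.D.toDomains) → Finset (geo9Y x).Site) (Bc : ℝ) (hBc : 0 ≤ Bc) (hM₀N : nbrM₀BY θ.d₆ θ.ℓ₆ θ.hd' θ.hL' θ.b₀ θ.b₁ 1 ≤ Mstar) (hB₀ge : (nbrCountBY θ.d₆ θ.ℓ₆ θ.hd' θ.hL' θ.b₀ θ.b₁ 1 : ℝ) * Real.exp (2 * p.δ₀) * (cR39 (trBasis N) * Bc) ≤ p.B₀)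
    -- [rows 18, ed. 115∕123∕125] (3.42) block tables `h36b` at the GENERIC CUBE LETTER `O` (laws `hnear hOagr hOsym hOloc hOlocT`); (3.46) per-cube legs `hMixO hOneO` + sandwiched member `hmixO` displayed
    -- [g32 «KE10XA»] THE SITE CUBE LETTER PINNED (node00-def-Y (Q1) road P4): `O x □ := GpDirY x.toKIdx □ (parKnitY x.toKIdx) (S x □)` = print's `G′_□(U) = (Ω₀Δ′_{a,□}(U)Ω₀)⁻¹`
    -- with Dirichlet exterior `S x □ = Ω₀(□)` — a BINDER until dag-n06-c's D3 names the placement; `supp h_□ ⊆ Ω₀(□)` displayed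
    (S : ∀ x : MemberY θ.d₆ θ.ℓ₆ θ.hd' θ.hL' θ.b₀ θ.b₁ Mstar, ↥(cubes x.toKIdx.D.toDomains) → Finset (SiteY x.toKIdx))
    (hSh : ∀ (x : MemberY θ.d₆ θ.ℓ₆ θ.hd' θ.hL' θ.b₀ θ.b₁ Mstar) (c' : ↥(cubes x.toKIdx.D.toDomains)) (z : SiteY x.toKIdx), hTY x.toKIdx c' z ≠ 0 → z ∈ S x c')
    (near : ∀ x : MemberY θ.d₆ θ.ℓ₆ θ.hd' θ.hL' θ.b₀ θ.b₁ Mstar, ↥(cubes x.toKIdx.D.toDomains) → Finset (SiteY x.toKIdx)) (hnear : ∀ (x : MemberY θ.d₆ θ.ℓ₆ θ.hd' θ.hL' θ.b₀ θ.b₁ Mstar) (c' : ↥(cubes x.toKIdx.D.toDomains)), nearDomY x c' ⊆ near x c')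
    -- [g32 «KE10XA»] `hOagr` CONSUMED (✓`B9KnitTransporterLocalityY.GpDirY_parKnitY_congr_of_agreeWalkYO`): what stays displayed is cover GEOMETRY — the reading domain contains Ω₀(□) and its knit reach
    (hSnear : ∀ (x : MemberY θ.d₆ θ.ℓ₆ θ.hd' θ.hL' θ.b₀ θ.b₁ Mstar) (c' : ↥(cubes x.toKIdx.D.toDomains)), S x c' ⊆ near x c')
    (hSblk : ∀ (x : MemberY θ.d₆ θ.ℓ₆ θ.hd' θ.hL' θ.b₀ θ.b₁ Mstar) (c' : ↥(cubes x.toKIdx.D.toDomains)), knitReachY x.toKIdx c' (S x c') ⊆ near x c')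
    -- [g32 «KE10XA»] `hOsym` CONSUMED behind the LETTER FACT «the knit legs are U(N)-valued on the class» (✓F `Node00.OpsYCubeDirInverseSymm.GpDirY_parKnitY_isSymmTr`; in the tree inside the
    -- [B7] Prop-2 window only, ✓`parKnitY_mem_unitary_of_reg335P`; unconditionally = the `mlog`-convention item, node00-def-Y (Q-sym) WORD 2026-08-31) — DISPLAYED
    (hparU : ∀ (x : MemberY θ.d₆ θ.ℓ₆ θ.hd' θ.hL' θ.b₀ θ.b₁ Mstar) (α₀ : ℝ) (U : (bg9YR (Matrix (Fin N) (Fin N) ℂ) (specialUnitaryUnits (Fin N)) R₁ R₂ x).Cfg), (bg9YR (Matrix (Fin N) (Fin N) ℂ) (specialUnitaryUnits (Fin N)) R₁ R₂ x).Reg335 c α₀ U → ∀ z w : SiteY x.toKIdx, parKnitY x.toKIdx U z w ∈ unitaryUnits (Matrix (Fin N) (Fin N) ℂ))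
    -- [g32 «KE10XA»] `hOloc`∕`hOlocT` CONSUMED (✓E row law + ✓F column law, `N06CubeDirInverseAtRecord.localInverse_laws_hTY_GpDirY`): what stays displayed is Cor. 3.6's POSITIVITY of the
    -- compressed cube operator `Ω₀Δ′_{a,□}(U; parKnitY)Ω₀ ⊕ 1` on the regime (an estimate of [B9] Thm 3.1 ∕ Cor. 3.6 for the sequence {Ω_n(□)}, NOT in the tree at the knit transporter)
    (hUnitD : ∀ x, p.M₁ ≤ (geo9Y x).M → ∀ α₀ : ℝ, 0 < α₀ → c * (geo9Y x).M * α₀ ≤ p.a₁ → ∀ U : (bg9YR (Matrix (Fin N) (Fin N) ℂ) (specialUnitaryUnits (Fin N)) R₁ R₂ x).Cfg, (bg9YR (Matrix (Fin N) (Fin N) ℂ) (specialUnitaryUnits (Fin N)) R₁ R₂ x).Reg335 c α₀ U → ∀ c' : ↥(cubes x.toKIdx.D.toDomains), IsUnit (padDeltaCubeY x.toKIdx c' (parKnitY x.toKIdx) (S x c') U))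
    (δM : ℝ) (hδM : 0 < δM) (hM1L : MLeg θ.d₆ θ.ℓ₆ θ.hd' θ.hL' θ.b₀ θ.b₁ Mstar hδM ≤ p.M₁) (hδ1L : p.δ₀ ≤ δM / 2) (hθ1L : p.θ₀ * Real.exp ((3 / 4 + p.δ₀) * p.ρ) * (BLeg θ.d₆ θ.ℓ₆ θ.hd' θ.hL' θ.b₀ θ.b₁ Mstar hδM * pM.BM) ≤ pM.θM) (hMixO : ∀ x, p.M₁ ≤ (geo9Y x).M → ∀ α₀ : ℝ, 0 < α₀ → c * (geo9Y x).M * α₀ ≤ p.a₁ → ∀ U : (bg9YR (Matrix (Fin N) (Fin N) ℂ) (specialUnitaryUnits (Fin N)) R₁ R₂ x).Cfg, (bg9YR (Matrix (Fin N) (Fin N) ℂ) (specialUnitaryUnits (Fin N)) R₁ R₂ x).Reg335 c α₀ U → ∀ (q' : ↥(cubes x.toKIdx.D.toDomains)) (ν μ : Fin (θ.d₆ + 1)), B9SectDL2Decay.BlockBd (g := toB6 (geo9Y x) 1 (H x)) (opsWalkYO x (trBasis N) (bg9YR (Matrix (Fin N) (Fin N) ℂ) (specialUnitaryUnits (Fin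 N)) R₁ R₂ x) (fun U => U) (parKnitY x.toKIdx) (bI x) (fun cc : ↥(cubes x.toKIdx.D.toDomains) => GpDirY x.toKIdx cc (parKnitY x.toKIdx) (S x cc))).blk (opsWalkYO x (trBasis N) (bg9YR (Matrix (Fin N) (Fin N) ℂ) (specialUnitaryUnits (Fin N)) R₁ R₂ x) (fun U => U) (parKnitY x.toKIdx) (bI x) (fun cc : ↥(cubes x.toKIdx.D.toDomains) => GpDirY x.toKIdx cc (parKnitY x.toKIdx) (S x cc))).blk ((dirOpsWalkYO x (trBasis N) (bg9YR (Matrix (Fin N) (Fin N) ℂ) (specialUnitaryUnits (Fin N)) R₁ R₂ x) (fun U => U) (parKnitY x.toKIdx) (bI x) (fun cc : ↥(cubes x.toKIdx.D.toDomains) => GpDirY x.toKIdx cc (parKnitY x.toKIdx) (S x cc))).Dd U ν ∘ₗ (((opsWalkYO x (trBasis N) (bg9YR (Matrix (Fin N) (Fin N) ℂ) (specialUnitaryUnits (Fin N)) R₁ R₂ x) (fun U => U) (parKnitY x.toKIdx) (bI x) (fun cc : ↥(cubes x.toKIdx.D.toDomains) => GpDirY x.toKIdx cc (parKnitY x.toKIdx)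 (S x cc))).Gsq U q' * B9Thm37Sum.mulOp ((opsWalkYO x (trBasis N) (bg9YR (Matrix (Fin N) (Fin N) ℂ) (specialUnitaryUnits (Fin N)) R₁ R₂ x) (fun U => U) (parKnitY x.toKIdx) (bI x) (fun cc : ↥(cubes x.toKIdx.D.toDomains) => GpDirY x.toKIdx cc (parKnitY x.toKIdx) (S x cc))).h q')) ∘ₗ (dirOpsWalkYO x (trBasis N) (bg9YR (Matrix (Fin N) (Fin N) ℂ) (specialUnitaryUnits (Fin N)) R₁ R₂ x) (fun U => U) (parKnitY x.toKIdx) (bI x) (fun cc : ↥(cubes x.toKIdx.D.toDomains) => GpDirY x.toKIdx cc (parKnitY x.toKIdx) (S x cc))).Dsd U μ)) (fun (y y' : (geo9Y x).Site) => pM.BM * Real.exp (-(δM * (geo9Y x).dist y y'))))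
    (hOneO : ∀ x, p.M₁ ≤ (geo9Y x).M → ∀ α₀ : ℝ, 0 < α₀ → c * (geo9Y x).M * α₀ ≤ p.a₁ → ∀ U : (bg9YR (Matrix (Fin N) (Fin N) ℂ) (specialUnitaryUnits (Fin N)) R₁ R₂ x).Cfg, (bg9YR (Matrix (Fin N) (Fin N) ℂ) (specialUnitaryUnits (Fin N)) R₁ R₂ x).Reg335 c α₀ U → ∀ (q' : ↥(cubes x.toKIdx.D.toDomains)) (μ : Fin (θ.d₆ + 1)), B9SectDL2Decay.BlockBd (g := toB6 (geo9Y x) 1 (H x)) (opsWalkYO x (trBasis N) (bg9YR (Matrix (Fin N) (Fin N) ℂ) (specialUnitaryUnits (Fin N)) R₁ R₂ x) (fun U => U) (parKnitY x.toKIdx) (bI x) (fun cc : ↥(cubes x.toKIdx.D.toDomains) => GpDirY x.toKIdx cc (parKnitY x.toKIdx) (S x cc))).blk (opsWalkYO x (trBasis N) (bg9YR (Matrix (Fin N) (Fin N) ℂ) (specialUnitaryUnits (Fin N)) R₁ R₂ x) (fun U => U) (parKnitY x.toKIdx) (bI x) (fun cc : ↥(cubes x.toKIdx.D.toDomains) =>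 GpDirY x.toKIdx cc (parKnitY x.toKIdx) (S x cc))).blk (((opsWalkYO x (trBasis N) (bg9YR (Matrix (Fin N) (Fin N) ℂ) (specialUnitaryUnits (Fin N)) R₁ R₂ x) (fun U => U) (parKnitY x.toKIdx) (bI x) (fun cc : ↥(cubes x.toKIdx.D.toDomains) => GpDirY x.toKIdx cc (parKnitY x.toKIdx) (S x cc))).Gsq U q' * B9Thm37Sum.mulOp ((opsWalkYO x (trBasis N) (bg9YR (Matrix (Fin N) (Fin N) ℂ) (specialUnitaryUnits (Fin N)) R₁ R₂ x) (fun U => U) (parKnitY x.toKIdx) (bI x) (fun cc : ↥(cubes x.toKIdx.D.toDomains) => GpDirY x.toKIdx cc (parKnitY x.toKIdx) (S x cc))).h q')) ∘ₗ (dirOpsWalkYO x (trBasis N) (bg9YR (Matrix (Fin N) (Fin N) ℂ) (specialUnitaryUnits (Fin N)) R₁ R₂ x) (fun U => U) (parKnitY x.toKIdx) (bI x) (fun cc : ↥(cubes x.toKIdx.D.toDomains) => GpDirY x.toKIdx cc (parKnitY x.toKIdx) (S x cc))).Dsd U μ) (fun (y y' : (geo9Y x).Site) => pM.BM * (geo9Y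 x).len y ^ (1 : ℝ) * Real.exp (-(δM * (geo9Y x).dist y y')))) (hmixO : ∀ x, p.M₁ ≤ (geo9Y x).M → ∀ α₀ : ℝ, 0 < α₀ → c * (geo9Y x).M * α₀ ≤ p.a₁ → ∀ U : (bg9YR (Matrix (Fin N) (Fin N) ℂ) (specialUnitaryUnits (Fin N)) R₁ R₂ x).Cfg, (bg9YR (Matrix (Fin N) (Fin N) ℂ) (specialUnitaryUnits (Fin N)) R₁ R₂ x).Reg335 c α₀ U → L2MixedLegs37 (opsWalkYO x (trBasis N) (bg9YR (Matrix (Fin N) (Fin N) ℂ) (specialUnitaryUnits (Fin N)) R₁ R₂ x) (fun U => U) (parKnitY x.toKIdx) (bI x) (fun cc : ↥(cubes x.toKIdx.D.toDomains) => GpDirY x.toKIdx cc (parKnitY x.toKIdx) (S x cc))) (dirOpsWalkYO x (trBasis N) (bg9YR (Matrix (Fin N) (Fin N) ℂ) (specialUnitaryUnits (Fin N)) R₁ R₂ x) (fun U => U) (parKnitY x.toKIdx) (bI x) (fun cc : ↥(cubes x.toKIdx.D.toDomains) => GpDirY x.toKIdx cc (parKnitY x.toKIdx) (S x cc))) 1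 (H x) (SblkY x (bI x)) pM.BM p.δ₀ U) (h36b : ∀ x, p.M₁ ≤ (geo9Y x).M → ∀ α₀ : ℝ, 0 < α₀ → c * (geo9Y x).M * α₀ ≤ p.a₁ → ∀ U : (bg9YR (Matrix (Fin N) (Fin N) ℂ) (specialUnitaryUnits (Fin N)) R₁ R₂ x).Cfg, (bg9YR (Matrix (Fin N) (Fin N) ℂ) (specialUnitaryUnits (Fin N)) R₁ R₂ x).Reg335 c α₀ U → (∀ c', HasMajorant (g := toB6 (geoBY x) 1 (H x)) (fun p' : SiteY x.toKIdx × TrIdx N => blkOf x.toKIdx.D.toDomains p'.1) (conj (trBasis N) ((etaS x.toKIdx ^ 2) • (GpDirY x.toKIdx c' (parKnitY x.toKIdx) (S x c') U).restrictScalars ℝ)) (fun s s' => Bc * (geoBY x).len s ^ 2 * Real.exp (-(p.δ₀ * (geoBY x).dist s s')))) ∧ (∀ c' (μ : Fin (θ.d₆ + 1)), HasMajorant (g := toB6 (geoBY x) 1 (H x)) (fun p' : SiteY x.toKIdx × TrIdx N => blkOf x.toKIdx.D.toDomains p'.1) (conj (trBasis N) (diffLetter (shiftY x.toKIdx) (UboxY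 x.toKIdx U) (((etaS x.toKIdx : ℂ))⁻¹) (Sum.inl μ)) * conj (trBasis N) ((etaS x.toKIdx ^ 2) • (GpDirY x.toKIdx c' (parKnitY x.toKIdx) (S x c') U).restrictScalars ℝ)) (fun s s' => Bc * (geoBY x).len s * Real.exp (-(p.δ₀ * (geoBY x).dist s s')))) ∧ (∀ c' (μ : Fin (θ.d₆ + 1)), HasMajorant (g := toB6 (geoBY x) 1 (H x)) (fun p' : SiteY x.toKIdx × TrIdx N => blkOf x.toKIdx.D.toDomains p'.1) (conj (trBasis N) ((etaS x.toKIdx ^ 2) • (GpDirY x.toKIdx c' (parKnitY x.toKIdx) (S x c') U).restrictScalars ℝ) * conj (trBasis N) (diffLetter (shiftY x.toKIdx) (UboxY x.toKIdx U) (((etaS x.toKIdx : ℂ))⁻¹) (Sum.inr μ))) (fun s s' => Bc * (geoBY x).len s * Real.exp (-(p.δ₀ * (geoBY x).dist s s')))) ∧ (∀ c', HasMajorant (g := toB6 (geoBY x) 1 (H x)) (fun p' : SiteY x.toKIdx × TrIdx N => blkOf x.toKIdx.D.toDomains p'.1) (conj (trBasis N) (((etaS x.toKIdx ^ 2)⁻¹)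 • (lapSL x.toKIdx U).restrictScalars ℝ) * conj (trBasis N) ((etaS x.toKIdx ^ 2) • (GpDirY x.toKIdx c' (parKnitY x.toKIdx) (S x c') U).restrictScalars ℝ)) (fun s s' => Bc * 1 * Real.exp (-(p.δ₀ * (geoBY x).dist s s')))))
    (h36H : ∀ x, p.M₁ ≤ (geo9Y x).M → ∀ α₀ : ℝ, 0 < α₀ → c * (geo9Y x).M * α₀ ≤ p.a₁ → ∀ U : (bg9YR (Matrix (Fin N) (Fin N) ℂ) (specialUnitaryUnits (Fin N)) R₁ R₂ x).Cfg, (bg9YR (Matrix (Fin N) (Fin N) ℂ) (specialUnitaryUnits (Fin N)) R₁ R₂ x).Reg335 c α₀ U → HolderLegs37 (opsWalkYO x (trBasis N) (bg9YR (Matrix (Fin N) (Fin N) ℂ) (specialUnitaryUnits (Fin N)) R₁ R₂ x) (fun U => U) (parKnitY x.toKIdx) (bI x) (fun cc : ↥(cubes x.toKIdx.D.toDomains) => GpDirY x.toKIdx cc (parKnitY x.toKIdx) (S x cc))) (𝔭 x) 1 (H x) (SH x) p.Bl p.δ₀ U ∧ HolderV37Dir (opsWalkYO x (trBasis N) (bg9YR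 (Matrix (Fin N) (Fin N) ℂ) (specialUnitaryUnits (Fin N)) R₁ R₂ x) (fun U => U) (parKnitY x.toKIdx) (bI x) (fun cc : ↥(cubes x.toKIdx.D.toDomains) => GpDirY x.toKIdx cc (parKnitY x.toKIdx) (S x cc))) (dirOpsWalkYO x (trBasis N) (bg9YR (Matrix (Fin N) (Fin N) ℂ) (specialUnitaryUnits (Fin N)) R₁ R₂ x) (fun U => U) (parKnitY x.toKIdx) (bI x) (fun cc : ↥(cubes x.toKIdx.D.toDomains) => GpDirY x.toKIdx cc (parKnitY x.toKIdx) (S x cc))) (dirLettersWalkYO x (trBasis N) (bg9YR (Matrix (Fin N) (Fin N) ℂ) (specialUnitaryUnits (Fin N)) R₁ R₂ x) (fun U => U) (parKnitY x.toKIdx) (bI x) (fun cc : ↥(cubes x.toKIdx.D.toDomains) => GpDirY x.toKIdx cc (parKnitY x.toKIdx) (S x cc))) (𝔭 x) 1 (H x) p.Bt p.δ₀ U ∧ (L2SecondLegs37 (opsWalkYO x (trBasis N) (bg9YR (Matrix (Fin N) (Fin N) ℂ) (specialUnitaryUnits (Fin N)) R₁ R₂ x) (fun U => U) (parKnitY x.toKIdx)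 (bI x) (fun cc : ↥(cubes x.toKIdx.D.toDomains) => GpDirY x.toKIdx cc (parKnitY x.toKIdx) (S x cc))) (dirOpsWalkYO x (trBasis N) (bg9YR (Matrix (Fin N) (Fin N) ℂ) (specialUnitaryUnits (Fin N)) R₁ R₂ x) (fun U => U) (parKnitY x.toKIdx) (bI x) (fun cc : ↥(cubes x.toKIdx.D.toDomains) => GpDirY x.toKIdx cc (parKnitY x.toKIdx) (S x cc))) 1 (H x) (S3 x) p3.B3 p.δ₀ U ∧ (∀ q' μ, IsTransposePair ((dirLettersWalkYO x (trBasis N) (bg9YR (Matrix (Fin N) (Fin N) ℂ) (specialUnitaryUnits (Fin N)) R₁ R₂ x) (fun U => U) (parKnitY x.toKIdx) (bI x) (fun cc : ↥(cubes x.toKIdx.D.toDomains) => GpDirY x.toKIdx cc (parKnitY x.toKIdx) (S x cc))).Pt U q' μ) ((dirLettersWalkYO x (trBasis N) (bg9YR (Matrix (Fin N) (Fin N) ℂ) (specialUnitaryUnits (Fin N)) R₁ R₂ x) (fun U => U) (parKnitY x.toKIdx) (bI x) (fun cc : ↥(cubes x.toKIdx.D.toDomains) => GpDirY x.toKIdx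 cc (parKnitY x.toKIdx) (S x cc))).P U q' μ)) ∧ (∀ q', IsTransposePair ((opsWalkYO x (trBasis N) (bg9YR (Matrix (Fin N) (Fin N) ℂ) (specialUnitaryUnits (Fin N)) R₁ R₂ x) (fun U => U) (parKnitY x.toKIdx) (bI x) (fun cc : ↥(cubes x.toKIdx.D.toDomains) => GpDirY x.toKIdx cc (parKnitY x.toKIdx) (S x cc))).Ct U q') ((opsWalkYO x (trBasis N) (bg9YR (Matrix (Fin N) (Fin N) ℂ) (specialUnitaryUnits (Fin N)) R₁ R₂ x) (fun U => U) (parKnitY x.toKIdx) (bI x) (fun cc : ↥(cubes x.toKIdx.D.toDomains) => GpDirY x.toKIdx cc (parKnitY x.toKIdx) (S x cc))).Cop U q'))) ∧ (InputLegsPair37 (opsWalkYO x (trBasis N) (bg9YR (Matrix (Fin N) (Fin N) ℂ) (specialUnitaryUnits (Fin N)) R₁ R₂ x) (fun U => U) (parKnitY x.toKIdx) (bI x) (fun cc : ↥(cubes x.toKIdx.D.toDomains) => GpDirY x.toKIdx cc (parKnitY x.toKIdx) (S x cc))) (dirOpsWalkYO x (trBasis N) (bg9YR (Matrix (Fin N)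 (Fin N) ℂ) (specialUnitaryUnits (Fin N)) R₁ R₂ x) (fun U => U) (parKnitY x.toKIdx) (bI x) (fun cc : ↥(cubes x.toKIdx.D.toDomains) => GpDirY x.toKIdx cc (parKnitY x.toKIdx) (S x cc))) (𝔭 x) 1 (H x) (bHX x) (SI x) p.BI p.BI2 p.δ₀ U ∧ FactorsInputPair37Dir (opsWalkYO x (trBasis N) (bg9YR (Matrix (Fin N) (Fin N) ℂ) (specialUnitaryUnits (Fin N)) R₁ R₂ x) (fun U => U) (parKnitY x.toKIdx) (bI x) (fun cc : ↥(cubes x.toKIdx.D.toDomains) => GpDirY x.toKIdx cc (parKnitY x.toKIdx) (S x cc))) (dirOpsWalkYO x (trBasis N) (bg9YR (Matrix (Fin N) (Fin N) ℂ) (specialUnitaryUnits (Fin N)) R₁ R₂ x) (fun U => U) (parKnitY x.toKIdx) (bI x) (fun cc : ↥(cubes x.toKIdx.D.toDomains) => GpDirY x.toKIdx cc (parKnitY x.toKIdx) (S x cc))) (dirLettersWalkYO x (trBasis N) (bg9YR (Matrix (Fin N) (Fin N) ℂ) (specialUnitaryUnits (Fin N)) R₁ R₂ x) (fun U => U) (parKnitY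 x.toKIdx) (bI x) (fun cc : ↥(cubes x.toKIdx.D.toDomains) => GpDirY x.toKIdx cc (parKnitY x.toKIdx) (S x cc))) 1 (H x) (bHX x) p.θI p.δ₀ U)) (hcntH : ∀ x (a : (geo9Y x).Site), (∑ c, if a ∈ SH x c then (1 : ℝ) else 0) ≤ p.NH) (hcnt3 : ∀ x (a : (geo9Y x).Site), (∑ c, if a ∈ S3 x c then (1 : ℝ) else 0) ≤ p3.N3) (hcntI : ∀ x (a : (geo9Y x).Site), (∑ c, if a ∈ SI x c then (1 : ℝ) else 0) ≤ p.NI) (hMw : ∀ x : MemberY θ.d₆ θ.ℓ₆ θ.hd' θ.hL' θ.b₀ θ.b₁ Mstar, walkCntM₀Y θ.d₆ θ.ℓ₆ θ.hd' θ.hL' θ.b₀ θ.b₁ Mstar ≤ (geo9Y x).M) (hNMw : walkCntY θ.d₆ θ.ℓ₆ θ.hd' θ.hL' θ.b₀ θ.b₁ Mstar ≤ pM.NM) (hM3 : nbrM₀Y θ.d₆ θ.ℓ₆ θ.hd' θ.hL' θ.b₀ θ.b₁ 3 ≤ Mstar) (hρ3 : 3 ≤ p.ρ) (hNc : walkCntY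 θ.d₆ θ.ℓ₆ θ.hd' θ.hL' θ.b₀ θ.b₁ Mstar ≤ p.Nc) (hN' : walkCntY θ.d₆ θ.ℓ₆ θ.hd' θ.hL' θ.b₀ θ.b₁ Mstar ≤ p.N') (hCℓ : (((θ.ℓ₆ + 1 : ℕ) : ℝ)) ^ 2 ≤ p.Cℓ) (hKc : KcWalkY θ.d₆ θ.ℓ₆ θ.hd' θ.hL' θ.b₀ θ.b₁ (trBasis N) ≤ p.Kc) (hθ₀ : thetaWalkY θ.d₆ θ.ℓ₆ θ.hd' θ.hL' θ.b₀ θ.b₁ (trBasis N) p.Cℓ ≤ p.θ₀)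
    -- [W-b] THE rows-19 BOND-SECTOR WALK LETTERS INSTANTIATED (`𝔬A := ops310WalkYO …`, ✓`B9WalkLettersOps310`): the cube letters `OcA`, print's `Δ_a` on the bond carrier `ΔaA`, the (3.105) factor families `RfA ∕ RtA` with localisations `SFA`, the reading domain `nearA` and the factor agreement `AgreeFA` stay GENERIC ((Q1) = P0)
    (OcA : ∀ x : MemberY θ.d₆ θ.ℓ₆ θ.hd' θ.hL' θ.b₀ θ.b₁ Mstar, ↥(cubes x.toKIdx.D.toDomains) → BondOpY (Matrix (Fin N) (Fin N) ℂ) x.toKIdx)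
    (ΔaA : ∀ x : MemberY θ.d₆ θ.ℓ₆ θ.hd' θ.hL' θ.b₀ θ.b₁ Mstar, (bg9YR (Matrix (Fin N) (Fin N) ℂ) (specialUnitaryUnits (Fin N)) R₁ R₂ x).Cfg → Module.End ℝ (XBK (TrIdx N) x.toKIdx → ℝ))
    (RfA RtA : ∀ x : MemberY θ.d₆ θ.ℓ₆ θ.hd' θ.hL' θ.b₀ θ.b₁ Mstar, (bg9YR (Matrix (Fin N) (Fin N) ℂ) (specialUnitaryUnits (Fin N)) R₁ R₂ x).Cfg → AA x → Module.End ℝ (XBK (TrIdx N) x.toKIdx → ℝ))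
    (SFA : ∀ x : MemberY θ.d₆ θ.ℓ₆ θ.hd' θ.hL' θ.b₀ θ.b₁ Mstar, AA x → Finset (geo9Y x).Site)
    (nearA : ∀ x : MemberY θ.d₆ θ.ℓ₆ θ.hd' θ.hL' θ.b₀ θ.b₁ Mstar, ↥(cubes x.toKIdx.D.toDomains) → Finset (SiteY x.toKIdx))
    (AgreeFA : ∀ x : MemberY θ.d₆ θ.ℓ₆ θ.hd' θ.hL' θ.b₀ θ.b₁ Mstar, AA x → (bg9YR (Matrix (Fin N) (Fin N) ℂ) (specialUnitaryUnits (Fin N)) R₁ R₂ x).Cfg → (bg9YR (Matrix (Fin N) (Fin N) ℂ) (specialUnitaryUnits (Fin N)) R₁ R₂ x).Cfg → Prop)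
    -- [W-b] the static thresholds of the bond record (site ones: `hρ3 hNc hN' hCℓ hKc`) and the count of the generic factor localisations
    (hρ3A : 3 ≤ q.ρ) (hNcA : walkCntY θ.d₆ θ.ℓ₆ θ.hd' θ.hL' θ.b₀ θ.b₁ Mstar ≤ q.Nc) (hN'A : walkCntY θ.d₆ θ.ℓ₆ θ.hd' θ.hL' θ.b₀ θ.b₁ Mstar ≤ q.N') (hCℓA : (((θ.ℓ₆ + 1 : ℕ) : ℝ)) ^ 2 ≤ q.Cℓ) (hKcA : KcWalkY θ.d₆ θ.ℓ₆ θ.hd' θ.hL' θ.b₀ θ.b₁ (trBasis N) ≤ q.Kc)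
    (hcntFA : ∀ (x : MemberY θ.d₆ θ.ℓ₆ θ.hd' θ.hL' θ.b₀ θ.b₁ Mstar) (a : (geo9Y x).Site), (∑ q', if a ∈ SFA x q' then (1 : ℝ) else 0) ≤ q.NF)
    -- [W-b] what is left DISPLAYED of `h36A'`: the (3.89)-type factor bounds of the families `RfA ∕ RtA` at the instance, and the four U-laws of the generic letters ((3.27) `GΔ_a = Δ_aG = 1`, (3.105) «Δ_aG₀ = I − R» and its transpose)
    (hfacA : ∀ x, q.M₁ ≤ (geo9Y x).M → ∀ α₀ : ℝ, 0 < α₀ → c * (geo9Y x).M * α₀ ≤ q.a₁ → ∀ U : (bg9YR (Matrix (Fin N) (Fin N) ℂ) (specialUnitaryUnits (Fin N)) R₁ R₂ x).Cfg, (bg9YR (Matrix (Fin N) (Fin N) ℂ) (specialUnitaryUnits (Fin N)) R₁ R₂ x).Reg335 c α₀ U → B9Thm310Whole.Factors389 (ops310WalkYO x (trBasis N) (bg9YR (Matrix (Fin N) (Fin N) ℂ) (specialUnitaryUnits (Fin N)) R₁ R₂ x) (fun U => U) (bI x) (lettersYOfRecordV11K N θ.toStage3Params Mstar (resYOfRecordPK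 N θ.toStage3Params Mstar) x).GA (OcA x) (ΔaA x) (RfA x) (RtA x) (SFA x)) 1 (H x) q.θ₀ q.δ₀ U)
    (hlawsA : ∀ x, q.M₁ ≤ (geo9Y x).M → ∀ α₀ : ℝ, 0 < α₀ → c * (geo9Y x).M * α₀ ≤ q.a₁ → ∀ U : (bg9YR (Matrix (Fin N) (Fin N) ℂ) (specialUnitaryUnits (Fin N)) R₁ R₂ x).Cfg, (bg9YR (Matrix (Fin N) (Fin N) ℂ) (specialUnitaryUnits (Fin N)) R₁ R₂ x).Reg335 c α₀ U → GcoK x.toKIdx (trBasis N) (bg9YR (Matrix (Fin N) (Fin N) ℂ) (specialUnitaryUnits (Fin N)) R₁ R₂ x) (fun U => U) (lettersYOfRecordV11K N θ.toStage3Params Mstar (resYOfRecordPK N θ.toStage3Params Mstar) x).GA U * ΔaA x U = 1 ∧ ΔaA x U * GcoK x.toKIdx (trBasis N) (bg9YR (Matrix (Fin N) (Fin N) ℂ) (specialUnitaryUnits (Fin N)) R₁ R₂ x) (fun U => U) (lettersYOfRecordV11K N θ.toStage3Params Mstar (resYOfRecordPK N θ.toStage3Params Mstar) x).GA U = 1 ∧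 ΔaA x U * (∑ c', B9Thm37Sum.mulOp (hWalkBY x c') * GcoK x.toKIdx (trBasis N) (bg9YR (Matrix (Fin N) (Fin N) ℂ) (specialUnitaryUnits (Fin N)) R₁ R₂ x) (fun U => U) (OcA x c') U * B9Thm37Sum.mulOp (hWalkBY x c')) = 1 - ∑ a, RfA x U a ∧ (∑ c', B9Thm37Sum.mulOp (hWalkBY x c') * GcoK x.toKIdx (trBasis N) (bg9YR (Matrix (Fin N) (Fin N) ℂ) (specialUnitaryUnits (Fin N)) R₁ R₂ x) (fun U => U) (OcA x c') U * B9Thm37Sum.mulOp (hWalkBY x c')) * ΔaA x U = 1 - ∑ a, RtA x U a)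
    -- [W-b] locality of the generic letters (print p.410 l.14–15 «G_□ depends on U restricted to Ω₀(□)», p.413 «R_α(X) … U restricted to X̃⁵»)
    (hOagrA : ∀ (x : MemberY θ.d₆ θ.ℓ₆ θ.hd' θ.hL' θ.b₀ θ.b₁ Mstar) (c' : ↥(cubes x.toKIdx.D.toDomains)) (U U' : (bg9YR (Matrix (Fin N) (Fin N) ℂ) (specialUnitaryUnits (Fin N)) R₁ R₂ x).Cfg), agree310WalkYO x (bg9YR (Matrix (Fin N) (Fin N) ℂ) (specialUnitaryUnits (Fin N)) R₁ R₂ x) (fun U => U) (nearA x) c' U U' → OcA x c' U = OcA x c' U')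
    (hRfagrA : ∀ (x : MemberY θ.d₆ θ.ℓ₆ θ.hd' θ.hL' θ.b₀ θ.b₁ Mstar) (a : AA x) (U U' : (bg9YR (Matrix (Fin N) (Fin N) ℂ) (specialUnitaryUnits (Fin N)) R₁ R₂ x).Cfg), AgreeFA x a U U' → RfA x U a = RfA x U' a)
    (𝔭A : ∀ x : MemberY θ.d₆ θ.ℓ₆ θ.hd' θ.hL' θ.b₀ θ.b₁ Mstar, HolderProbes (geo9Y x) (bg9YR (Matrix (Fin N) (Fin N) ℂ) (specialUnitaryUnits (Fin N)) R₁ R₂ x) (XBK (TrIdx N) x.toKIdx) (XBK (TrIdx N) x.toKIdx) (PK (FBondY x.toKIdx) (Fin (θ.d₆ + 1)) (TrIdx N)) (PK (FBondY x.toKIdx) (Fin (θ.d₆ + 1)) (TrIdx N))) (h𝔭A : ∀ x : MemberY θ.d₆ θ.ℓ₆ θ.hd' θ.hL' θ.b₀ θ.b₁ Mstar, 𝔭A x = holderProbesKA x.toKIdx (trBasis N) (bg9YR (Matrix (Fin N) (Fin N) ℂ) (specialUnitaryUnits (Fin N)) R₁ R₂ x) (fun U => U) (lettersYOfRecordV11K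 N θ.toStage3Params Mstar (resYOfRecordPK N θ.toStage3Params Mstar) x).parB (bI x)) (bHXA : ∀ x : MemberY θ.d₆ θ.ℓ₆ θ.hd' θ.hL' θ.b₀ θ.b₁ Mstar, ℝ → BlockNorm (toB6 (geo9Y x) 1 (H x)) ((XBK (TrIdx N) x.toKIdx) → ℝ)) (SHA S3A SIA SMA : ∀ x : MemberY θ.d₆ θ.ℓ₆ θ.hd' θ.hL' θ.b₀ θ.b₁ Mstar, ↥(cubes x.toKIdx.D.toDomains) → Finset (geo9Y x).Site) (hbHXA : ∀ x : MemberY θ.d₆ θ.ℓ₆ θ.hd' θ.hL' θ.b₀ θ.b₁ Mstar, bHXA x = fun ε => letI : Fintype (B9GeoNormsKLevelV1.geo9K x.toKIdx).Site := (inferInstance : Fintype (geo9Y x).Site); bHK x.toKIdx (bI x) ε) (h36HA : ∀ x, q.M₁ ≤ (geo9Y x).M → ∀ α₀ : ℝ, 0 < α₀ → c * (geo9Y x).M * α₀ ≤ q.a₁ → ∀ U : (bg9YR (Matrix (Fin N) (Fin N) ℂ) (specialUnitaryUnits (Fin N)) R₁ R₂ x).Cfg, (bg9YR (Matrix (Fin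 N) (Fin N) ℂ) (specialUnitaryUnits (Fin N)) R₁ R₂ x).Reg335 c α₀ U → HolderLegs310 (ops310WalkYO x (trBasis N) (bg9YR (Matrix (Fin N) (Fin N) ℂ) (specialUnitaryUnits (Fin N)) R₁ R₂ x) (fun U => U) (bI x) (lettersYOfRecordV11K N θ.toStage3Params Mstar (resYOfRecordPK N θ.toStage3Params Mstar) x).GA (OcA x) (ΔaA x) (RfA x) (RtA x) (SFA x)) (𝔭A x) 1 (H x) (SHA x) q.Bl q.δ₀ U ∧ FactorsHolder310 (ops310WalkYO x (trBasis N) (bg9YR (Matrix (Fin N) (Fin N) ℂ) (specialUnitaryUnits (Fin N)) R₁ R₂ x) (fun U => U) (bI x) (lettersYOfRecordV11K N θ.toStage3Params Mstar (resYOfRecordPK N θ.toStage3Params Mstar) x).GA (OcA x) (ΔaA x) (RfA x) (RtA x) (SFA x)) (𝔭A x) 1 (H x) q.Bt q.δ₀ U ∧ (L2SecondLegs310 (ops310WalkYO x (trBasis N) (bg9YR (Matrix (Fin N) (Fin N) ℂ) (specialUnitaryUnits (Fin N)) R₁ R₂ x) (fun U => U) (bI x) (lettersYOfRecordV11K N θ.toStage3Params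 Mstar (resYOfRecordPK N θ.toStage3Params Mstar) x).GA (OcA x) (ΔaA x) (RfA x) (RtA x) (SFA x)) (dirOps310WalkYO x (trBasis N) (bg9YR (Matrix (Fin N) (Fin N) ℂ) (specialUnitaryUnits (Fin N)) R₁ R₂ x) (fun U => U) (bI x) (lettersYOfRecordV11K N θ.toStage3Params Mstar (resYOfRecordPK N θ.toStage3Params Mstar) x).GA (OcA x) (ΔaA x) (RfA x) (RtA x) (SFA x)) 1 (H x) (S3A x) q3.B3 q.δ₀ U ∧ ∀ a, IsTransposePair ((ops310WalkYO x (trBasis N) (bg9YR (Matrix (Fin N) (Fin N) ℂ) (specialUnitaryUnits (Fin N)) R₁ R₂ x) (fun U => U) (bI x) (lettersYOfRecordV11K N θ.toStage3Params Mstar (resYOfRecordPK N θ.toStage3Params Mstar) x).GA (OcA x) (ΔaA x) (RfA x) (RtA x) (SFA x)).Rt U a) ((ops310WalkYO x (trBasis N) (bg9YR (Matrix (Fin N) (Fin N) ℂ) (specialUnitaryUnits (Fin N)) R₁ R₂ x) (fun U => U) (bI x) (lettersYOfRecordV11K N θ.toStage3Params Mstar (resYOfRecordPK N θ.toStage3Params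 Mstar) x).GA (OcA x) (ΔaA x) (RfA x) (RtA x) (SFA x)).Rf U a)) ∧ (InputLegsPair310 (ops310WalkYO x (trBasis N) (bg9YR (Matrix (Fin N) (Fin N) ℂ) (specialUnitaryUnits (Fin N)) R₁ R₂ x) (fun U => U) (bI x) (lettersYOfRecordV11K N θ.toStage3Params Mstar (resYOfRecordPK N θ.toStage3Params Mstar) x).GA (OcA x) (ΔaA x) (RfA x) (RtA x) (SFA x)) (dirOps310WalkYO x (trBasis N) (bg9YR (Matrix (Fin N) (Fin N) ℂ) (specialUnitaryUnits (Fin N)) R₁ R₂ x) (fun U => U) (bI x) (lettersYOfRecordV11K N θ.toStage3Params Mstar (resYOfRecordPK N θ.toStage3Params Mstar) x).GA (OcA x) (ΔaA x) (RfA x) (RtA x) (SFA x)) (𝔭A x) 1 (H x) (bHXA x) (SIA x) q.BI q.BI2 q.δ₀ U ∧ FactorsInputPair310 (ops310WalkYO x (trBasis N) (bg9YR (Matrix (Fin N) (Fin N) ℂ) (specialUnitaryUnits (Fin N)) R₁ R₂ x) (fun U => U) (bI x) (lettersYOfRecordV11K N θ.toStage3Params Mstar (resYOfRecordPK N θ.toStage3Params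 Mstar) x).GA (OcA x) (ΔaA x) (RfA x) (RtA x) (SFA x)) (dirOps310WalkYO x (trBasis N) (bg9YR (Matrix (Fin N) (Fin N) ℂ) (specialUnitaryUnits (Fin N)) R₁ R₂ x) (fun U => U) (bI x) (lettersYOfRecordV11K N θ.toStage3Params Mstar (resYOfRecordPK N θ.toStage3Params Mstar) x).GA (OcA x) (ΔaA x) (RfA x) (RtA x) (SFA x)) 1 (H x) (bHXA x) q.θI q.δ₀ U) ∧ (L2MixedLegs310 (ops310WalkYO x (trBasis N) (bg9YR (Matrix (Fin N) (Fin N) ℂ) (specialUnitaryUnits (Fin N)) R₁ R₂ x) (fun U => U) (bI x) (lettersYOfRecordV11K N θ.toStage3Params Mstar (resYOfRecordPK N θ.toStage3Params Mstar) x).GA (OcA x) (ΔaA x) (RfA x) (RtA x) (SFA x)) (dirOps310WalkYO x (trBasis N) (bg9YR (Matrix (Fin N) (Fin N) ℂ) (specialUnitaryUnits (Fin N)) R₁ R₂ x) (fun U => U) (bI x) (lettersYOfRecordV11K N θ.toStage3Params Mstar (resYOfRecordPK N θ.toStage3Params Mstar) x).GA (OcA x) (ΔaA x) (RfA x) (RtA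 x) (SFA x)) 1 (H x) (SMA x) qM.BM q.δ₀ U ∧ FactorsL2Mixed310 (ops310WalkYO x (trBasis N) (bg9YR (Matrix (Fin N) (Fin N) ℂ) (specialUnitaryUnits (Fin N)) R₁ R₂ x) (fun U => U) (bI x) (lettersYOfRecordV11K N θ.toStage3Params Mstar (resYOfRecordPK N θ.toStage3Params Mstar) x).GA (OcA x) (ΔaA x) (RfA x) (RtA x) (SFA x)) (dirOps310WalkYO x (trBasis N) (bg9YR (Matrix (Fin N) (Fin N) ℂ) (specialUnitaryUnits (Fin N)) R₁ R₂ x) (fun U => U) (bI x) (lettersYOfRecordV11K N θ.toStage3Params Mstar (resYOfRecordPK N θ.toStage3Params Mstar) x).GA (OcA x) (ΔaA x) (RfA x) (RtA x) (SFA x)) 1 (H x) qM.θM q.δ₀ U)) (hcntHA : ∀ x (a : (geo9Y x).Site), (∑ c, if a ∈ SHA x c then (1 : ℝ) else 0) ≤ q.NH) (hcnt3A : ∀ x (a : (geo9Y x).Site), (∑ c, if a ∈ S3A x c then (1 : ℝ) else 0) ≤ q3.N3) (hcntIA : ∀ x (a : (geo9Y x).Site), (∑ c, if a ∈ SIA x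 c then (1 : ℝ) else 0) ≤ q.NI) (hcntMA : ∀ x (a : (geo9Y x).Site), (∑ c, if a ∈ SMA x c then (1 : ℝ) else 0) ≤ qM.NM) 
    
    -- [rows 19, ed. 119] the bond cube letters `G_□(U) := OcA x □ U`, their (3.42) block tables `h36Ab` (`Local342G` DERIVED)
    (BcA : ℝ) (hBcA : 0 ≤ BcA) (hB₀geA : (nbrCountBY θ.d₆ θ.ℓ₆ θ.hd' θ.hL' θ.b₀ θ.b₁ 1 : ℝ) * Real.exp (2 * q.δ₀) * (cR39 (trBasis N) * BcA) ≤ q.B₀) (h36Ab : ∀ x, q.M₁ ≤ (geo9Y x).M → ∀ α₀ : ℝ, 0 < α₀ → c * (geo9Y x).M * α₀ ≤ q.a₁ → ∀ U : (bg9YR (Matrix (Fin N) (Fin N) ℂ) (specialUnitaryUnits (Fin N)) R₁ R₂ x).Cfg, (bg9YR (Matrix (Fin N) (Fin N) ℂ) (specialUnitaryUnits (Fin N)) R₁ R₂ x).Reg335 c α₀ U → (∀ j, HasMajorant (g := toB6 (geoBY x) 1 (H x)) (fun p' : FBondY x.toKIdx × TrIdx N => blkV1 x.toKIdx.hN x.toKIdx.D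 p'.1) (conj (trBasis N) ((OcA x j U).restrictScalars ℝ)) (fun s s' => BcA * (geoBY x).len s ^ 2 * Real.exp (-(q.δ₀ * (geoBY x).dist s s')))) ∧ (∀ j (ν : Fin (θ.d₆ + 1)), HasMajorant (g := toB6 (geoBY x) 1 (H x)) (fun p' : FBondY x.toKIdx × TrIdx N => blkV1 x.toKIdx.hN x.toKIdx.D p'.1) (conj (trBasis N) (B9CoReadingCoords.cdBₗ x.toKIdx U ν) * conj (trBasis N) ((OcA x j U).restrictScalars ℝ)) (fun s s' => BcA * (geoBY x).len s * Real.exp (-(q.δ₀ * (geoBY x).dist s s')))) ∧ (∀ j (ν : Fin (θ.d₆ + 1)), HasMajorant (g := toB6 (geoBY x) 1 (H x)) (fun p' : FBondY x.toKIdx × TrIdx N => blkV1 x.toKIdx.hN x.toKIdx.D p'.1) (conj (trBasis N) ((OcA x j U).restrictScalars ℝ) * conj (trBasis N) (B9CoReadingCoords.cdsBₗ x.toKIdx U ν)) (fun s s' => BcA * (geoBY x).len s * Real.exp (-(q.δ₀ * (geoBY x).dist s s')))) ∧ (∀ j, HasMajorant (g := toB6 (geoBY x) 1 (H x)) (fun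 p' : FBondY x.toKIdx × TrIdx N => blkV1 x.toKIdx.hN x.toKIdx.D p'.1) (conj (trBasis N) (B9CoReadingCoords.lapBₗ x.toKIdx U) * conj (trBasis N) ((OcA x j U).restrictScalars ℝ)) (fun s s' => BcA * 1 * Real.exp (-(q.δ₀ * (geoBY x).dist s s'))))) (𝔬12 : ∀ x : MemberY θ.d₆ θ.ℓ₆ θ.hd' θ.hL' θ.b₀ θ.b₁ Mstar, B9Thm312Whole.Ops (geo9Y x) (bg9YR (Matrix (Fin N) (Fin N) ℂ) (specialUnitaryUnits (Fin N)) R₁ R₂ x) (XBK (TrIdx N) x.toKIdx) (XBK (TrIdx N) x.toKIdx) (XHK (TrIdx N) x.toKIdx) (XSK (TrIdx N) x.toKIdx))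
    -- gen 28 «KE₇X»: the twenty-two `𝔬12` pins `hblk12 … hRco12` FOLDED into ONE equation (node00-def-Y `OpsYOps312OfRecordPar.pins312K_of_eq`)
    (h𝔬12 : 𝔬12 = OpsYOps312OfRecordPar.ops312YOfRecordK N θ.toStage3Params Mstar (resYOfRecordPK N θ.toStage3Params Mstar) R₁ R₂ bI)
    -- [«KE₃X»] THE E-LETTER EXPS RECORD IS PINNED: `𝔈 := expsYOfRecordV3Par … (lettersYOfRecordV11K … resYOfRecordPK …) 𝔈₀ R₁ R₂ bI parKnitY parSymY qKnitOfRecord qsKnitOfRecord α' r39 B39 p q p3 q3 pM qM H O near 𝔬A rdA 𝔬12` (node00-def-Y W2 ✓`OpsYExpsOfRecordV3Par`; the former display `h𝔈` closes by `rfl`) — the object below reads it in place of the free `𝔈`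
    -- (editions 97∕99∕101) Thm 3.13's block-L² pair record of rows 20–21 is ASSEMBLED from the legs `g0qstar_l2_letters_of_pins` (n06-l), `dv_letters_of_pins`, `rgdI_of_pinsR`, `rgdDs_rgdDd_of_pinsR` (n06-c); its `C₁` line is derived INSIDE dag-n06-l's face v1.6 `…StateSUCL` — no field displayed
    -- rows 20–21's `Letters313DZ ∕ DMZ` records SPLIT (edition 53): the four non-Hölder fields displayed, the Hölder entries `dgDH ∕ dgDHd` DERIVED (`N06DgLegAtPinsPhysPU`, ed. 61) from the (3.44) members `h44m` below
    {E14₁ E14₂ : ∀ x : MemberY θ.d₆ θ.ℓ₆ θ.hd' θ.hL' θ.b₀ θ.b₁ Mstar, B9.RWExpansion (geo9Y x) (bg9YR (Matrix (Fin N) (Fin N) ℂ) (specialUnitaryUnits (Fin N)) R₁ R₂ x)} (T14₁ : ∀ x : MemberY θ.d₆ θ.ℓ₆ θ.hd' θ.hL' θ.b₀ θ.b₁ Mstar, (E14₁ x).Walk → BondOpY (Matrix (Fin N) (Fin N) ℂ) x.toKIdx) (T14₂ : ∀ x : MemberY θ.d₆ θ.ℓ₆ θ.hd' θ.hL' θ.b₀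 θ.b₁ Mstar, (E14₂ x).Walk → BondOpY (Matrix (Fin N) (Fin N) ℂ) x.toKIdx) (X14₁ : ∀ x : MemberY θ.d₆ θ.ℓ₆ θ.hd' θ.hL' θ.b₀ θ.b₁ Mstar, (E14₁ x).Walk → ℕ → (geo9Y x).Site → Prop) (M14₁ : ∀ x : MemberY θ.d₆ θ.ℓ₆ θ.hd' θ.hL' θ.b₀ θ.b₁ Mstar, (E14₁ x).Walk → ℕ → Prop) (X14₂ : ∀ x : MemberY θ.d₆ θ.ℓ₆ θ.hd' θ.hL' θ.b₀ θ.b₁ Mstar, (E14₂ x).Walk → ℕ → (geo9Y x).Site → Prop) (M14₂ : ∀ x : MemberY θ.d₆ θ.ℓ₆ θ.hd' θ.hL' θ.b₀ θ.b₁ Mstar, (E14₂ x).Walk → ℕ → Prop) (diam14 : MemberY θ.d₆ θ.ℓ₆ θ.hd' θ.hL' θ.b₀ θ.b₁ Mstar → ℝ) (r14 : ℝ) (hr14 : ∀ x, diam14 x ≤ r14) (near14₁ : ∀ (x : MemberY θ.d₆ θ.ℓ₆ θ.hd' θ.hL' θ.b₀ θ.b₁ Mstar) ω m p, M14₁ x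 ω m → X14₁ x ω m p → ∃ q, q ∈ OmegaC x.D x.D' ∧ tdistK (ℓ := θ.ℓ₆) (Mh := x.Mh) (k := x.k) (P := x.P') (kLab x p) q ≤ diam14 x) (first14₁ : ∀ (x : MemberY θ.d₆ θ.ℓ₆ θ.hd' θ.hL' θ.b₀ θ.b₁ Mstar) ω y, (E14₁ x).first ω y → X14₁ x ω 0 y) (chain14₁ : ∀ (x : MemberY θ.d₆ θ.ℓ₆ θ.hd' θ.hL' θ.b₀ θ.b₁ Mstar) ω y y', (E14₁ x).first ω y → (E14₁ x).last ω y' → ∃ l : List (geo9Y x).Site, l.length = (E14₁ x).wlen ω ∧ (∀ (m : ℕ) (hm : m < l.length), X14₁ x ω (m + 1) (l[m])) ∧ B9Thm314.chainSum (geo9Y x).dist y l y' ≤ (E14₁ x).wdist ω y y') (near14₂ : ∀ (x : MemberY θ.d₆ θ.ℓ₆ θ.hd' θ.hL' θ.b₀ θ.b₁ Mstar) ω m p, M14₂ x ω m → X14₂ x ω m p → ∃ q, q ∈ OmegaC x.D x.D' ∧ tdistK (ℓ := θ.ℓ₆) (Mh := x.Mh) (k := x.k) (P := x.P') (kLab x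 p) q ≤ diam14 x) (first14₂ : ∀ (x : MemberY θ.d₆ θ.ℓ₆ θ.hd' θ.hL' θ.b₀ θ.b₁ Mstar) ω y, (E14₂ x).first ω y → X14₂ x ω 0 y) (chain14₂ : ∀ (x : MemberY θ.d₆ θ.ℓ₆ θ.hd' θ.hL' θ.b₀ θ.b₁ Mstar) ω y y', (E14₂ x).first ω y → (E14₂ x).last ω y' → ∃ l : List (geo9Y x).Site, l.length = (E14₂ x).wlen ω ∧ (∀ (m : ℕ) (hm : m < l.length), X14₂ x ω (m + 1) (l[m])) ∧ B9Thm314.chainSum (geo9Y x).dist y l y' ≤ (E14₂ x).wdist ω y y') (h14₁ : Thm310AllNormsPrinted c geo9Y (bg9YR (Matrix (Fin N) (Fin N) ℂ) (specialUnitaryUnits (Fin N)) R₁ R₂) E14₁ (fun x ω => kernelFamilyB x.toKIdx (bg9YR (Matrix (Fin N) (Fin N) ℂ) (specialUnitaryUnits (Fin N)) R₁ R₂ x) (fun U => U) (T14₁ x ω) (lettersYOfRecordV11K N θ.toStage3Params Mstar (resYOfRecordPK N θ.toStage3Params Mstar) x).parB)) (h14₂ : Thm310AllNormsPrinted c geo9Y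 (bg9YR (Matrix (Fin N) (Fin N) ℂ) (specialUnitaryUnits (Fin N)) R₁ R₂) E14₂ (fun x ω => kernelFamilyB x.toKIdx (bg9YR (Matrix (Fin N) (Fin N) ℂ) (specialUnitaryUnits (Fin N)) R₁ R₂ x) (fun U => U) (T14₂ x ω) (lettersYOfRecordV11K N θ.toStage3Params Mstar (resYOfRecordPK N θ.toStage3Params Mstar) x).parB)) (W14₁ : ∀ x : MemberY θ.d₆ θ.ℓ₆ θ.hd' θ.hL' θ.b₀ θ.b₁ Mstar, ℕ → (geo9Y x).Site → (geo9Y x).Site → Finset (E14₁ x).Walk) (W14₂ : ∀ x : MemberY θ.d₆ θ.ℓ₆ θ.hd' θ.hL' θ.b₀ θ.b₁ Mstar, ℕ → (geo9Y x).Site → (geo9Y x).Site → Finset (E14₂ x).Walk) (hW14₁ : ∀ x, WalkSetsSpec (E14₁ x) (W14₁ x)) (hW14₂ : ∀ x, WalkSetsSpec (E14₂ x) (W14₂ x)) (hcnt14₁ : WalkWeightsSummable geo9Y (bg9YR (Matrix (Fin N) (Fin N) ℂ) (specialUnitaryUnits (Fin N)) R₁ R₂) E14₁ W14₁) (hcnt14₂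 : WalkWeightsSummable geo9Y (bg9YR (Matrix (Fin N) (Fin N) ℂ) (specialUnitaryUnits (Fin N)) R₁ R₂) E14₂ W14₂)
    (hexp14 : ∀ (x : MemberY θ.d₆ θ.ℓ₆ θ.hd' θ.hL' θ.b₀ θ.b₁ Mstar) (U : (bg9YR (Matrix (Fin N) (Fin N) ℂ) (specialUnitaryUnits (Fin N)) R₁ R₂ x).Cfg), (E14₁ x).Converges U ∧ (E14₂ x).Converges U → ExpansionReads x.toKIdx (B := bg9YR (Matrix (Fin N) (Fin N) ℂ) (specialUnitaryUnits (Fin N)) R₁ R₂ x) (fun U => U) (lettersYOfRecordV11K N θ.toStage3Params Mstar (resYOfRecordPK N θ.toStage3Params Mstar) x).Kdiff (pairOp (locDataY x (E14₁ x) (X14₁ x) (M14₁ x) (diam14 x)).Touches (locData₂ (locDataY x (E14₁ x) (X14₁ x) (M14₁ x) (diam14 x)) (X14₂ x) (M14₂ x)).Touches (T14₁ x) (T14₂ x)) (pairWalkSets (W14₁ x) (W14₂ x) (locDataY x (E14₁ x) (X14₁ x) (M14₁ x) (diam14 x)).Touches (locData₂ (locDataY x (E14₁ x) (X14₁ x)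 (M14₁ x) (diam14 x)) (X14₂ x) (M14₂ x)).Touches) U) {a₀E δ₁E B₁E : ℝ} (ha₀E : 0 < a₀E) (hδ₁E : 0 < δ₁E) (hB₁E : 0 < B₁E) (hE : ∀ (x : MemberY θ.d₆ θ.ℓ₆ θ.hd' θ.hL' θ.b₀ θ.b₁ Mstar), (Mstar : ℝ) ≤ (geo9Y x).M → ∀ (α₀ : ℝ), 0 < α₀ → (geo9Y x).M * α₀ ≤ a₀E → ∀ U : (bg9YR (Matrix (Fin N) (Fin N) ℂ) (specialUnitaryUnits (Fin N)) R₁ R₂ x).Cfg, (bg9YR (Matrix (Fin N) (Fin N) ℂ) (specialUnitaryUnits (Fin N)) R₁ R₂ x).Reg335 c α₀ U → (bg9YR (Matrix (Fin N) (Fin N) ℂ) (specialUnitaryUnits (Fin N)) R₁ R₂ x).Reg336 c α₀ U → givenBy3185stY x (lettersYOfRecordV11K N θ.toStage3Params Mstar (resYOfRecordPK N θ.toStage3Params Mstar) x) (sectEStYOfRecordV7 N θ.toStage3Params Mstar 𝔢₀ x) U ∧ hasRWExpCY (𝔴 x) U δ₁E ∧ DecayMidOnStY x (lettersYOfRecordV11K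 N θ.toStage3Params Mstar (resYOfRecordPK N θ.toStage3Params Mstar) x) (sectEStYOfRecordV7 N θ.toStage3Params Mstar 𝔢₀ x) B₁E U δ₁E) {J : Type} (f : J → MemberY θ.d₆ θ.ℓ₆ θ.hd' θ.hL' θ.b₀ θ.b₁ Mstar) {ιR : Type} [Fintype ιR] [DecidableEq ιR] (bR : Module.Basis ιR ℝ (Matrix (Fin N) (Fin N) ℂ)) (ιB : ∀ j : J, BlkY (f j).toKIdx → IBondY (f j).toKIdx) (C38 : ∀ j : J, ℝ → CfgY (Matrix (Fin N) (Fin N) ℂ) (f j).toKIdx → AfldY (Matrix (Fin N) (Fin N) ℂ) (f j).toKIdx → Prop)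
    -- [«ed.2» X] THE KNIT CODED CLASS's CONSTANTS (dag-n06-c `B9SectBCodedClassKnitY.C37KY`: knit letters constant `CqK`, member thresholds `MK ∕ aInv`, [B8] Prop-7 window `ϱ′` in `β₀ := ϱ′·L³∕3`)
    (CqK MK aInv ϱ' : ℝ)
    -- [CASCADE-K K3] ROW 17 DISPLAYED AT THE KNIT LETTER (Thm 3.11's `Δ_a^Q(U)` symmetric and positive definite over (3.115)'s `Q` and the knit contours — K2 supplier: dag-n06-j `B9Thm311FormGapOfLawsAtLettersY`; the straight-pair reader `row17_of_row19_letters₂` is pinned to `(parSymY, GAY)`)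
    -- gen 29 «KE₈X»: ROW 17 CONSUMED at every SECTION-CARRYING member (dag-n06-j ✓p804809, named thresholds `knitRow17M₁ ∕ knitRow17a₁`); `MR := knitRow17M₁ …`;
    -- the ONLY row-17 display left is at the NON-section-carrying (`β` not onto = inner-corner) members — NOT excluded by print's (2.1)–(2.4)∕(4); row 17 there is OPEN in the tree (label of record, director-ym №524)
    (ha17 : q.a₁ / c ≤ B9Thm311KnitRow17ThresholdsY.knitRow17a₁ N θ.toStage3Params Mstar) (hΔAKn : ∀ x : MemberY θ.d₆ θ.ℓ₆ θ.hd' θ.hL' θ.b₀ θ.b₁ Mstar, ¬ Function.Surjective (β x.hN x.D x.hk) → B9Thm311KnitRow17ThresholdsY.knitRow17M₁ N θ.toStage3Params Mstar ≤ (geo9Y x).M → ∀ α₀ : ℝ, 0 < α₀ → (geo9Y x).M * α₀ ≤ q.a₁ / c → ∀ U : (bg9YR (Matrix (Fin N) (Fin N) ℂ) (specialUnitaryUnits (Fin N)) R₁ R₂ x).Cfg, (bg9YR (Matrix (Fin N) (Fin N) ℂ) (specialUnitaryUnits (Fin N)) R₁ R₂ x).Reg335 c α₀ U → IsSymmTr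 (fun _ => (1 : ℝ)) (deltaAQY x.toKIdx (qKnitOfRecord N θ.toStage3Params x.toKIdx) (qsKnitOfRecord N θ.toStage3Params x.toKIdx) (parKnitY x.toKIdx) (GpY x.toKIdx (parKnitY x.toKIdx)) U) ∧ PosDefTr (fun _ => (1 : ℝ)) (deltaAQY x.toKIdx (qKnitOfRecord N θ.toStage3Params x.toKIdx) (qsKnitOfRecord N θ.toStage3Params x.toKIdx) (parKnitY x.toKIdx) (GpY x.toKIdx (parKnitY x.toKIdx)) U))
    -- [CASCADE-K K3] THE SECT.-D OUTPUTS DISPLAYED (Thms 3.12 ∕ 3.13 at the object; the V4P-keyed network `t312_t313_of_pins_stateSUCLE` is re-pressed at the knit letters in the companion file «K3-D», dag-n06-l item 4), (3.49) DISPLAYED (n06-i's site reader is pinned to `G′ = GpY parSymY`; def-Y K0-H-P349), (3.132) DISPLAYED (n06-l's `s3132Nu_…` consumes the network's state layer)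
    -- [CASCADE-K K1] THE CODED SECT.-B STEP AT THE KNIT LETTERS WITH THE TWO TRANSPORTERS, DISPLAYED (dag-n06-c's (C) road `sectBStepUPar_of_members`; the `hB` input of `B9LeafXCodedKnitUParH.b9LeafX_carriersYUParH`)
    -- [«KE6X»] THE CODED SECT.-B STEP `hBK` IS FOLDED (dag-n06-c ✓`N06SectBStepUParKnitRecordKC.sectBStepUPar_knitRecordKC` at the knit class `C37KY`, its `hunitA` from `hΔAK` by `isUnit_of_posDefTr`); its x-free displays follow (n06-c's list VERBATIM): LOCATED-RANGE `N ≤ 25`, the block-labelling pin of `ιB`, the basis data of `bR`, the knit class constants' signs ∕ thresholds, `8α₀K ≤ c₂′`, dag-n06-l's [B8] Prop-7 window `ϱ′ ϱ`, the neighbour count, `2(d+1) < MInv`, `r_LB + 1 < MInv` — jointly inhabited by ✓`N06SectBKnitWindow.knitSectBWindow_inhabited`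
    (hι : ∀ (j : J) (s : BlkY (f j).toKIdx), β (f j).toKIdx.hN (f j).toKIdx.D (f j).toKIdx.hk (ιB j s) = s) (hCqK : 0 ≤ CqK) (haInv : 0 < aInv) (haIR : aInv ≤ q.a₁ / c) (hα8 : 8 * α₀K ≤ c2' (θ.d₆ + 1) (θ.ℓ₆ + 1)) (hα4N : 32 * (((θ.d₆ + 1 : ℕ) : ℝ) + 1) * ((θ.d₆ + 1 : ℕ) + 4) * (((θ.ℓ₆ + 1 : ℕ) : ℝ)) ^ 2 * α₀K ≤ 1 / 4) (hαπN : (N : ℝ) * (32 * (((θ.d₆ + 1 : ℕ) : ℝ) + 1) * ((θ.d₆ + 1 : ℕ) + 4) * (((θ.ℓ₆ + 1 : ℕ) : ℝ)) ^ 2 * α₀K) < Real.pi) (haIK : aInv ≤ aK) (ϱ : ℝ) (hϱ' : 0 < ϱ') (hϱ : 0 < ϱ) (hsmall' : Real.exp (4 * (800 * ((((θ.d₆ + 1 : ℕ) : ℝ)) + 1) ^ 2 * ((((θ.d₆ + 1 : ℕ) : ℝ)) + 4)) * α₀K) * (1 + 8 * (131072 * ((((θ.d₆ + 1 : ℕ)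 : ℝ)) + 1) ^ 2) * ϱ') ≤ 2) (hc₃' : 2 * ϱ' ≤ c3 (θ.d₆ + 1) (θ.ℓ₆ + 1)) (hϱ'1 : 409600 * ((((θ.d₆ + 1 : ℕ) : ℝ)) + 1) ^ 2 * ϱ' ≤ 1) (hEc : Literature.MathematicalPhysics.QuantumFieldTheory.Balaban1983to89.B7Prop5CplxLevels.epsCplx (θ.d₆ + 1) (θ.ℓ₆ + 1) ϱ' 0 ≤ 1 / 16) (hdX : (((θ.d₆ + 1 : ℕ) : ℝ)) * (Literature.MathematicalPhysics.QuantumFieldTheory.Balaban1983to89.B7Prop5CplxLevels.epsCplx (θ.d₆ + 1) (θ.ℓ₆ + 1) ϱ' 0 + Literature.MathematicalPhysics.QuantumFieldTheory.Balaban1983to89.B7Prop5CplxLevels.tauCplx (θ.d₆ + 1) (θ.ℓ₆ + 1) α₀K 0 ϱ' 0) ≤ 1 / 16) (hsmall : Real.exp (4480 * ((((θ.d₆ + 1 : ℕ) : ℝ)) + 1) ^ 2 * ((((θ.d₆ + 1 : ℕ) : ℝ)) + 4) * α₀K + 240000 * ((((θ.d₆ + 1 : ℕ) : ℝ)) + 1)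 ^ 3 * ϱ') * (1 + 8 * (2097152 * ((((θ.d₆ + 1 : ℕ) : ℝ)) + 1) ^ 2) * ϱ) ≤ 2) (hc₃ : 2 * ϱ ≤ c3 (θ.d₆ + 1) (θ.ℓ₆ + 1) / 4) (hM₀K : nbrM₀Y θ.d₆ θ.ℓ₆ θ.hd' θ.hL' θ.b₀ θ.b₁ (2 * ((θ.d₆ : ℝ) + 1)) ≤ Mstar)
    -- [CASCADE-K «KC»] THE SECT.-D NETWORK's INPUTS (the binders of «KD» `t312_t313_opsYSectESt_knit_KD` that «KA» does not already carry): edition 125's network numerics ∕ tables, the 22 pins of the Sect.-D operator record, the Sect.-D composite letter pins and the displayed KNIT LAWS (node00-def-Y ruling (α))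
    (hRP2 : ∀ (x : MemberY θ.d₆ θ.ℓ₆ θ.hd' θ.hL' θ.b₀ θ.b₁ Mstar) (α₀ : ℝ) (U : (bg9YR (Matrix (Fin N) (Fin N) ℂ) (specialUnitaryUnits (Fin N)) R₁ R₂ x).Cfg), (bg9YR (Matrix (Fin N) (Fin N) ℂ) (specialUnitaryUnits (Fin N)) R₁ R₂ x).Reg336 c α₀ U → 0 ≤ α₀ ∧ (bg9YP (Matrix (Fin N) (Fin N) ℂ) (specialUnitaryUnits (Fin N)) x).Reg336 c35Y α₀ U) (hα3 : 3 * p.α ≤ (1 - p.αF) * (1 - 2 * p.α)) (bHXT : ∀ x : MemberY θ.d₆ θ.ℓ₆ θ.hd' θ.hL' θ.b₀ θ.b₁ Mstar, (bg9YR (Matrix (Fin N) (Fin N) ℂ) (specialUnitaryUnits (Fin N)) R₁ R₂ x).Cfg → ℝ → BlockNorm (toB6 (geo9Y x) 1 (H x)) ((XSK (TrIdx N) x.toKIdx) → ℝ)) (hbHXT : ∀ (x : MemberY θ.d₆ θ.ℓ₆ θ.hd' θ.hL' θ.b₀ θ.b₁ Mstar) (U : (bg9YR (Matrix (Fin N)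 (Fin N) ℂ) (specialUnitaryUnits (Fin N)) R₁ R₂ x).Cfg), bHXT x U = fun ε => letI : Fintype (B9GeoNormsKLevelV1.geo9K x.toKIdx).Site := (inferInstance : Fintype (geo9Y x).Site); bHZPIfam (κ := TrIdx N) x.toKIdx (trBasis N) (taxiS x.toKIdx (bg9YR (Matrix (Fin N) (Fin N) ℂ) (specialUnitaryUnits (Fin N)) R₁ R₂ x) (fun U => U) U) (R := (1 : ℝ)) (H := H x) ε) (hopI : ∀ x, p.M₁ ≤ (geo9Y x).M → ∀ α₀ : ℝ, 0 < α₀ → c * (geo9Y x).M * α₀ ≤ p.a₁ → ∀ U : (bg9YR (Matrix (Fin N) (Fin N) ℂ) (specialUnitaryUnits (Fin N)) R₁ R₂ x).Cfg, (bg9YR (Matrix (Fin N) (Fin N) ℂ) (specialUnitaryUnits (Fin N)) R₁ R₂ x).Reg335 c α₀ U → InputLegsPair37 (opsWalkYO x (trBasis N) (bg9YR (Matrix (Fin N) (Fin N) ℂ) (specialUnitaryUnits (Fin N)) R₁ R₂ x) (fun U => U) (parKnitY x.toKIdx) (bI x) (fun cc : ↥(cubes x.toKIdx.D.toDomains) =>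 GpDirY x.toKIdx cc (parKnitY x.toKIdx) (S x cc))) (dirOpsWalkYO x (trBasis N) (bg9YR (Matrix (Fin N) (Fin N) ℂ) (specialUnitaryUnits (Fin N)) R₁ R₂ x) (fun U => U) (parKnitY x.toKIdx) (bI x) (fun cc : ↥(cubes x.toKIdx.D.toDomains) => GpDirY x.toKIdx cc (parKnitY x.toKIdx) (S x cc))) (𝔭 x) 1 (H x) (bHXT x U) (SI x) p.BI p.BI2 p.δ₀ U ∧ FactorsInputPair37Dir (opsWalkYO x (trBasis N) (bg9YR (Matrix (Fin N) (Fin N) ℂ) (specialUnitaryUnits (Fin N)) R₁ R₂ x) (fun U => U) (parKnitY x.toKIdx) (bI x) (fun cc : ↥(cubes x.toKIdx.D.toDomains) => GpDirY x.toKIdx cc (parKnitY x.toKIdx) (S x cc))) (dirOpsWalkYO x (trBasis N) (bg9YR (Matrix (Fin N) (Fin N) ℂ) (specialUnitaryUnits (Fin N)) R₁ R₂ x) (fun U => U) (parKnitY x.toKIdx) (bI x) (fun cc : ↥(cubes x.toKIdx.D.toDomains) => GpDirY x.toKIdx cc (parKnitY x.toKIdx) (S x cc))) (dirLettersWalkYO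 x (trBasis N) (bg9YR (Matrix (Fin N) (Fin N) ℂ) (specialUnitaryUnits (Fin N)) R₁ R₂ x) (fun U => U) (parKnitY x.toKIdx) (bI x) (fun cc : ↥(cubes x.toKIdx.D.toDomains) => GpDirY x.toKIdx cc (parKnitY x.toKIdx) (S x cc))) 1 (H x) (bHXT x U) p.θI p.δ₀ U) (S2A : ∀ x : MemberY θ.d₆ θ.ℓ₆ θ.hd' θ.hL' θ.b₀ θ.b₁ Mstar, ↥(cubes x.toKIdx.D.toDomains) → Finset (geo9Y x).Site) (bHXTA : ∀ x : MemberY θ.d₆ θ.ℓ₆ θ.hd' θ.hL' θ.b₀ θ.b₁ Mstar, (bg9YR (Matrix (Fin N) (Fin N) ℂ) (specialUnitaryUnits (Fin N)) R₁ R₂ x).Cfg → ℝ → BlockNorm (toB6 (geo9Y x) 1 (H x)) ((XBK (TrIdx N) x.toKIdx) → ℝ)) (hbHXTA : ∀ (x : MemberY θ.d₆ θ.ℓ₆ θ.hd' θ.hL' θ.b₀ θ.b₁ Mstar) (U : (bg9YR (Matrix (Fin N) (Fin N) ℂ) (specialUnitaryUnits (Fin N)) R₁ R₂ x).Cfg),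 bHXTA x U = fun ε => letI : Fintype (B9GeoNormsKLevelV1.geo9K x.toKIdx).Site := (inferInstance : Fintype (geo9Y x).Site); bHZKPIfam (κ := TrIdx N) x.toKIdx (trBasis N) (taxiB x.toKIdx (bg9YR (Matrix (Fin N) (Fin N) ℂ) (specialUnitaryUnits (Fin N)) R₁ R₂ x) (fun U => U) U) (R := (1 : ℝ)) (H := H x) ε) (hopIA : ∀ x, q.M₁ ≤ (geo9Y x).M → ∀ α₀ : ℝ, 0 < α₀ → c * (geo9Y x).M * α₀ ≤ q.a₁ → ∀ U : (bg9YR (Matrix (Fin N) (Fin N) ℂ) (specialUnitaryUnits (Fin N)) R₁ R₂ x).Cfg, (bg9YR (Matrix (Fin N) (Fin N) ℂ) (specialUnitaryUnits (Fin N)) R₁ R₂ x).Reg335 c α₀ U → InputLegsPair310 (ops310WalkYO x (trBasis N) (bg9YR (Matrix (Fin N) (Fin N) ℂ) (specialUnitaryUnits (Fin N)) R₁ R₂ x) (fun U => U) (bI x) (lettersYOfRecordV11K N θ.toStage3Params Mstar (resYOfRecordPK N θ.toStage3Params Mstar) x).GA (OcA x) (ΔaA x) (RfA x) (RtA x) (SFA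 x)) (dirOps310WalkYO x (trBasis N) (bg9YR (Matrix (Fin N) (Fin N) ℂ) (specialUnitaryUnits (Fin N)) R₁ R₂ x) (fun U => U) (bI x) (lettersYOfRecordV11K N θ.toStage3Params Mstar (resYOfRecordPK N θ.toStage3Params Mstar) x).GA (OcA x) (ΔaA x) (RfA x) (RtA x) (SFA x)) (𝔭A x) 1 (H x) (bHXTA x U) (SIA x) q.BI q.BI2 q.δ₀ U ∧ FactorsInputPair310 (ops310WalkYO x (trBasis N) (bg9YR (Matrix (Fin N) (Fin N) ℂ) (specialUnitaryUnits (Fin N)) R₁ R₂ x) (fun U => U) (bI x) (lettersYOfRecordV11K N θ.toStage3Params Mstar (resYOfRecordPK N θ.toStage3Params Mstar) x).GA (OcA x) (ΔaA x) (RfA x) (RtA x) (SFA x)) (dirOps310WalkYO x (trBasis N) (bg9YR (Matrix (Fin N) (Fin N) ℂ) (specialUnitaryUnits (Fin N)) R₁ R₂ x) (fun U => U) (bI x) (lettersYOfRecordV11K N θ.toStage3Params Mstar (resYOfRecordPK N θ.toStage3Params Mstar) x).GA (OcA x) (ΔaA x) (RfA x) (RtA x) (SFA x)) 1 (H x) (bHXTA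 x U) q.θI q.δ₀ U) (h36A2 : ∀ x, q.M₁ ≤ (geo9Y x).M → ∀ α₀ : ℝ, 0 < α₀ → c * (geo9Y x).M * α₀ ≤ q.a₁ → ∀ U : (bg9YR (Matrix (Fin N) (Fin N) ℂ) (specialUnitaryUnits (Fin N)) R₁ R₂ x).Cfg, (bg9YR (Matrix (Fin N) (Fin N) ℂ) (specialUnitaryUnits (Fin N)) R₁ R₂ x).Reg335 c α₀ U → L2TwoLegs310 (ops310WalkYO x (trBasis N) (bg9YR (Matrix (Fin N) (Fin N) ℂ) (specialUnitaryUnits (Fin N)) R₁ R₂ x) (fun U => U) (bI x) (lettersYOfRecordV11K N θ.toStage3Params Mstar (resYOfRecordPK N θ.toStage3Params Mstar) x).GA (OcA x) (ΔaA x) (RfA x) (RtA x) (SFA x)) 1 (H x) (S2A x) q.B2 q.δ₀ U ∧ FactorsL2_310 (ops310WalkYO x (trBasis N) (bg9YR (Matrix (Fin N) (Fin N) ℂ) (specialUnitaryUnits (Fin N)) R₁ R₂ x) (fun U => U) (bI x) (lettersYOfRecordV11K N θ.toStage3Params Mstar (resYOfRecordPK N θ.toStage3Params Mstar) x).GA (OcA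 x) (ΔaA x) (RfA x) (RtA x) (SFA x)) 1 (H x) q.θ2 q.δ₀ U) (hcnt2A : ∀ x (a : (geo9Y x).Site), (∑ c, if a ∈ S2A x c then (1 : ℝ) else 0) ≤ q.N2)
             (bH13 : ∀ x : MemberY θ.d₆ θ.ℓ₆ θ.hd' θ.hL' θ.b₀ θ.b₁ Mstar, (bg9YR (Matrix (Fin N) (Fin N) ℂ) (specialUnitaryUnits (Fin N)) R₁ R₂ x).Cfg → BlockNorm (toB6 (geo9Y x) 1 (H x)) (XSK (TrIdx N) x.toKIdx → ℝ)) (δ12₀ δK12 σ12 ρ12 a12 M12 B12₃ δ12₃ ρ13 α12 : ℝ) (ρf12 : ℝ) (hρf12 : 0 < ρf12) (hρf1 : ρf12 + σ12 ≤ (1 - α12) * ρ12) (hρf2 : ρf12 + 2 * σ12 + α12 * ρ12 ≤ ρ12) (hB12₃ : 0 ≤ B12₃) (hσ12 : 0 < σ12) (hρ12 : 0 < ρ12) (hρS12 : ρ12 ≤ δ12₀) (hρδ12 : ρ12 + 2 * σ12 ≤ δK12) (hρ₃12 : ρ12 + σ12 ≤ δ12₃) (ha12 : 0 < a12)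
    -- [«KE₂»] node00-def-Y's x-free knit numerics for the three folded laws (✓p795647 `OpsYKnitGuardAdaptersKD`): `4α₀ᴷ ≤ c₂′`, the B8-Prop-7 exponential window, `α₀ᴷ ≤ α_Q`, `k_col·α₀ᴷ < 1`, `a12 ≤ aK`
    (hαK4 : 4 * α₀K ≤ c2' (θ.d₆ + 1) (θ.ℓ₆ + 1)) (hexpK : Real.exp (4 * (800 * (((θ.d₆ + 1 : ℕ) : ℝ) + 1) ^ 2 * (((θ.d₆ + 1 : ℕ) : ℝ) + 4)) * α₀K) < 2) (hsmallK : kCol (θ.d₆ + 1) (θ.ℓ₆ + 1) * α₀K < 1) (ha12K : a12 ≤ aK) (hM12 : 0 < M12)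
    -- [«KE₃»] x-free knit numerics for the folded laws (dag-n06-l ✓`N06KnitLawsAtRecordKE`, ✓`N06Eq346KnitLegAtPinsR`): the (2.60) floor `2·log L ≤ δ12₃(2L²−1)M12` and the K-0 coercivity window `(d+1)²α₀ᴷ ≤ 1/100`
    (hM12q : (2 : ℝ) * Real.log (((θ.ℓ₆ + 1 : ℕ) : ℝ)) ≤ δ12₃ * (2 * ((θ.ℓ₆ : ℝ) + 1) ^ 2 - 1) * M12) (hαdK : ((θ.d₆ : ℝ) + 1) ^ 2 * α₀K ≤ 1 / 100) (hα12 : 0 < α12) (hα12' : α12 ≤ 1 / 2) (hδ₃₀ : δ12₃ < δ12₀) (hδ12₀ : δ12₀ ≤ (1 - 3 * q.αF) * ((1 - 2 * q.α) * q.δ₀)) (t12 δT12 ρS σS : ℝ) (ht12 : 0 ≤ t12) (hσS : 0 < σS) (hρST : ρS ≤ δT12) (hρS₀ : ρS + σS ≤ δ12₀) (hδKS : δK12 + q.αF * ((1 - 2 * q.α) * q.δ₀) ≤ ρS) (hσSK : σS ≤ δK12) (bXH : ∀ x : MemberY θ.d₆ θ.ℓ₆ θ.hd' θ.hL' θ.b₀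 θ.b₁ Mstar, (bg9YR (Matrix (Fin N) (Fin N) ℂ) (specialUnitaryUnits (Fin N)) R₁ R₂ x).Cfg → BlockNorm (toB6 (geo9Y x) 1 (H x)) (XBK (TrIdx N) x.toKIdx → ℝ)) (w13 wX : ℝ → ℝ) (hw13₀ : ∀ s, 0 ≤ w13 s) (hw13₁ : ∀ s, w13 s ≤ 1) (hwX₀ : ∀ s, 0 ≤ wX s) (hwX₁ : ∀ s, wX s ≤ 1) (hbH13 : ∀ (x : MemberY θ.d₆ θ.ℓ₆ θ.hd' θ.hL' θ.b₀ θ.b₁ Mstar) (U : (bg9YR (Matrix (Fin N) (Fin N) ℂ) (specialUnitaryUnits (Fin N)) R₁ R₂ x).Cfg), bH13 x U = letI : Fintype (B9GeoNormsKLevelV1.geo9K x.toKIdx).Site := (inferInstance : Fintype (geo9Y x).Site); bHZPG (κ := TrIdx N) x.toKIdx (trBasis N) (taxiS x.toKIdx (bg9YR (Matrix (Fin N) (Fin N) ℂ) (specialUnitaryUnits (Fin N)) R₁ R₂ x) (fun U => U) U) (R := (1 : ℝ)) (H := H x) w13 hw13₀ hw13₁) (hbXH : ∀ (x : MemberY θ.d₆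 θ.ℓ₆ θ.hd' θ.hL' θ.b₀ θ.b₁ Mstar) (U : (bg9YR (Matrix (Fin N) (Fin N) ℂ) (specialUnitaryUnits (Fin N)) R₁ R₂ x).Cfg), bXH x U = letI : Fintype (B9GeoNormsKLevelV1.geo9K x.toKIdx).Site := (inferInstance : Fintype (geo9Y x).Site); bHZKPG (κ := TrIdx N) x.toKIdx (trBasis N) (taxiB x.toKIdx (bg9YR (Matrix (Fin N) (Fin N) ℂ) (specialUnitaryUnits (Fin N)) R₁ R₂ x) (fun U => U) U) (R := (1 : ℝ)) (H := H x) wX hwX₀ hwX₁) (hρ13 : 0 < ρ13) (hρ13ρ : ρ13 + 5 * σ12 ≤ ρ12) (hσρ13 : 3 * σ12 < (1 - α12) * ρ13) (B13₄ : ℝ) (Bx13 : ℝ → ℝ) (hB13₄ : 0 ≤ B13₄) (hBx13 : ∀ β, 0 ≤ β → β < 1 → 0 ≤ Bx13 β) (tJ δB rT : ℝ) (ha1J : 10 * ((θ.ℓ₆ + 1 : ℕ) : ℝ) ^ 7 * a12 ≤ 1) (htJ : 2 * ((θ.d₆ : ℝ) + 1) * (((θ.ℓ₆ + 1 : ℕ)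 : ℝ)) ^ 3 * (N : ℝ) * (10 ^ 4 * ((θ.d₆ : ℝ) + 1) * (10 * ((θ.ℓ₆ + 1 : ℕ) : ℝ) ^ 7)) * Real.exp (3 * δB) ≤ tJ) (hrTP : rT ≤ min ((1 - 2 * p.α) * p.δ₀) δ39 / 8) (hrTB : rT ≤ δB) (hδT12 : 0 ≤ δT12) (hδTr : δT12 + 3 * σS + 3 * (q.αF * ((1 - 2 * q.α) * q.δ₀)) ≤ rT) (ϑF : ℝ) (hϑF : 2 * (10 * (((θ.ℓ₆ + 1 : ℕ) : ℝ)) * a12) * (1 + 10 * (((θ.ℓ₆ + 1 : ℕ) : ℝ)) * a12) * Real.exp (4 * (10 * (((θ.ℓ₆ + 1 : ℕ) : ℝ)) * a12)) * (((θ.ℓ₆ + 1 : ℕ) : ℝ)) ≤ ϑF) (sch : ℝ → ℝ) (hsch0 : ∀ β', 0 ≤ β' → β' < 1 → 0 < sch β') (hsch1 : ∀ β', 0 ≤ β' → β' < 1 → sch β' < 1) (hschβ : ∀ β', 0 ≤ β' → β' < 1 → β' < sch β') (hwsch : ∀ β', 0 ≤ β' → β' < 1 → 0 < w13 (sch β'))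 (δ45 : ℝ) (hδ45 : δ12₃ < δ45) (BZ : ℝ → ℝ) (hBZ : ∀ β', 0 ≤ β' → β' < 1 → 0 ≤ BZ β') (hBZge : ∀ β', 0 ≤ β' → β' < 1 → (((θ.ℓ₆ + 1 : ℕ) : ℝ)) * inputConst45 (exp261 (@geo9Y θ.d₆ θ.ℓ₆ θ.hd' θ.hL' θ.b₀ θ.b₁ Mstar) q.δ₀ q.α) q.δ₀ q.α q.NI q.NF (((θ.ℓ₆ + 1 : ℕ) : ℝ)) (holderConst (exp261 (@geo9Y θ.d₆ θ.ℓ₆ θ.hd' θ.hL' θ.b₀ θ.b₁ Mstar) q.δ₀ q.α) q.δ₀ q.α q.NH q.NF (const37 (exp261 (@geo9Y θ.d₆ θ.ℓ₆ θ.hd' θ.hL' θ.b₀ θ.b₁ Mstar) q.δ₀ q.α) q.δ₀ q.α q.ρ q.B₀ q.Nc q.N' q.Cℓ q.Kc) (q.Bl β') (q.Bt β')) (q.BI2 (sch β' - β') β') (q.θI (sch β')) ≤ BZ β') (hδ45le : δ45 ≤ ((1 - q.αF) * ((1 - 2 * q.α) * q.δ₀) - q.α * q.δ₀)) (δ₂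 : ℝ) (hrT4 : rT ≤ (Literature.MathematicalPhysics.QuantumFieldTheory.Balaban1983to89.B9Eq346GradGpDivAtPinsL2KnitClosed.δ46K θ.d₆ θ.ℓ₆ θ.hd' θ.hL' θ.b₀ θ.b₁ Mstar N c hc)) (hrT2 : rT ≤ δ₂) (hδ₃T : δ12₃ ≤ (1 - 2 * q.αF) * rT - σS) (hδ12₃F : δ12₃ ≤ (1 - 2 * p.αF) * ((1 - 2 * p.α) * p.δ₀)) (δ45Y : ℝ) (hδ45Y : δ12₃ < δ45Y) (BiY : ℝ → ℝ) (hBiY : ∀ β', 0 ≤ β' → β' < 1 → 0 ≤ BiY β') (αW σW δFW : ℝ) (hαW0 : 0 < αW) (hαW1 : αW < 1) (hσW : 0 < σW) (hδFW : 0 < δFW) (hδFP : δFW ≤ min ((1 - 2 * p.α) * p.δ₀) δ39 / 8) (hbudW : 0 ≤ δFW - αW * δFW - 2 * σW) (hδ3W : δ12₃ ≤ δFW - αW * δFW - 2 * σW)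
    (hwschX : ∀ β', 0 ≤ β' → β' < 1 → 0 < wX (sch β')) (δ45W : ℝ) (hδ45W : δFW - αW * δFW - 2 * σW ≤ δ45W) (B45W : ℝ → ℝ) (hB45W : ∀ β', 0 ≤ β' → β' < 1 → 0 ≤ B45W β') (δhW : ℝ) (hδhW : δFW - αW * δFW - σW ≤ δhW) (BhW : ℝ → ℝ) (hBhW : ∀ β', 0 ≤ β' → β' < 1 → 0 ≤ BhW β') (hB45Wge : ∀ β', 0 ≤ β' → β' < 1 → let Cσ : ℝ := ((((θ.ℓ₆ + 1 : ℕ) : ℝ)) * ((((θ.ℓ₆ + 1 : ℕ) : ℝ)) ^ 3 * (2 + 2 * coordBound39 (trBasis N) * basisBound39 (trBasis N) * (((θ.ℓ₆ + 1 : ℕ) : ℝ)) ^ 2)) * Real.exp ((1 - p.αF) * ((1 - 2 * p.α) * p.δ₀) * (2 * (rNear θ.d₆ θ.ℓ₆ + 1) + (((θ.d₆ : ℝ) + 1) * (((θ.ℓ₆ : ℝ) + 1) + 1) + 2)))); let X44 : ℝ := ((((θ.ℓ₆ + 1 : ℕ) : ℝ)) * ((1 + CLip θ.d₆ θ.ℓ₆)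 * inputConst44 (exp261 (@geo9Y θ.d₆ θ.ℓ₆ θ.hd' θ.hL' θ.b₀ θ.b₁ Mstar) p.δ₀ p.α) p.δ₀ p.α p.NI p.N' (p.C (exp261 (@geo9Y θ.d₆ θ.ℓ₆ θ.hd' θ.hL' θ.b₀ θ.b₁ Mstar) p.δ₀ p.α)) (((θ.ℓ₆ + 1 : ℕ) : ℝ)) (p.BI (sch β')) (p.θI (sch β')) * Cσ * B6.c1 (exp261 (@geo9Y θ.d₆ θ.ℓ₆ θ.hd' θ.hL' θ.b₀ θ.b₁ Mstar) p.δ₀ p.α) p.δ₀ p.α)); (((θ.d₆ + 1 : ℕ) : ℝ)) * ((((((θ.ℓ₆ + 1 : ℕ) : ℝ)) * ((1 + CLip θ.d₆ θ.ℓ₆) * inputConst45 (exp261 (@geo9Y θ.d₆ θ.ℓ₆ θ.hd' θ.hL' θ.b₀ θ.b₁ Mstar) p.δ₀ p.α) p.δ₀ p.α p.NI p.N' (((θ.ℓ₆ + 1 : ℕ) : ℝ)) (holderConst (exp261 (@geo9Y θ.d₆ θ.ℓ₆ θ.hd' θ.hL' θ.b₀ θ.b₁ Mstar) p.δ₀ p.α)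 p.δ₀ p.α p.NH p.N' (p.C (exp261 (@geo9Y θ.d₆ θ.ℓ₆ θ.hd' θ.hL' θ.b₀ θ.b₁ Mstar) p.δ₀ p.α)) (p.Bl β') (p.Bt β')) (p.BI2 (sch β' - β') β') (p.θI (sch β')) * Cσ * B6.c1 (exp261 (@geo9Y θ.d₆ θ.ℓ₆ θ.hd' θ.hL' θ.b₀ θ.b₁ Mstar) p.δ₀ p.α) p.δ₀ p.α)) + 2 * coordBound39 (trBasis N) * basisBound39 (trBasis N) * ((θ.ℓ₆ : ℝ) + 1) * Real.exp (((1 - p.αF) * ((1 - 2 * p.α) * p.δ₀) - 3 * (p.α * p.δ₀)) * (((θ.d₆ : ℝ) + 1) * (((θ.ℓ₆ : ℝ) + 1) + 1) + 2)) * ((((θ.d₆ + 1 : ℕ) : ℝ)) ^ 2 * (2 * (10 * (((θ.ℓ₆ + 1 : ℕ) : ℝ)) * (p.a₁ / c)) * (1 + 10 * (((θ.ℓ₆ + 1 : ℕ) : ℝ)) * (p.a₁ / c)) * Real.exp (4 * (10 * (((θ.ℓ₆ + 1 : ℕ) : ℝ)) * (p.a₁ / c)))) * (((θ.ℓ₆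 + 1 : ℕ) : ℝ)) ^ 6) * X44 + coordBound39 (trBasis N) * basisBound39 (trBasis N) * X44 + X44) + X44 + coordBound39 (trBasis N) * basisBound39 (trBasis N) * X44) ≤ B45W β') (hδ45Wle : δ45W ≤ ((1 - p.αF) * ((1 - 2 * p.α) * p.δ₀) - 3 * (p.α * p.δ₀))) (hBhWge : ∀ β', 0 ≤ β' → β' < 1 → ((B9RWSums343Holder.holderConst (B9RWSums347DefiniteFaces.exp261 (@geo9Y θ.d₆ θ.ℓ₆ θ.hd' θ.hL' θ.b₀ θ.b₁ Mstar) p.δ₀ p.α) p.δ₀ p.α p.NH p.N' (p.C (B9RWSums347DefiniteFaces.exp261 (@geo9Y θ.d₆ θ.ℓ₆ θ.hd' θ.hL' θ.b₀ θ.b₁ Mstar) p.δ₀ p.α)) (p.Bl β') (p.Bt β') + 2 * B9Thm39ReadingCoords.coordBound39 (trBasis N) * B9Thm39ReadingCoords.basisBound39 (trBasis N) * ((θ.ℓ₆ : ℝ) + 1) * Real.exp (((1 - 2 * p.α) * p.δ₀) * (((θ.d₆ : ℝ) + 1) * (((θ.ℓ₆ : ℝ) + 1) + 1) + 2)) * ((((θ.d₆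 + 1 : ℕ) : ℝ)) ^ 2 * (2 * (10 * ((θ.ℓ₆ + 1 : ℕ) : ℝ) * (p.a₁ / c)) * (1 + 10 * ((θ.ℓ₆ + 1 : ℕ) : ℝ) * (p.a₁ / c)) * Real.exp (4 * (10 * ((θ.ℓ₆ + 1 : ℕ) : ℝ) * (p.a₁ / c)))) * ((θ.ℓ₆ + 1 : ℕ) : ℝ) ^ 6) * (p.C (B9RWSums347DefiniteFaces.exp261 (@geo9Y θ.d₆ θ.ℓ₆ θ.hd' θ.hL' θ.b₀ θ.b₁ Mstar) p.δ₀ p.α)) + B9Thm39ReadingCoords.coordBound39 (trBasis N) * B9Thm39ReadingCoords.basisBound39 (trBasis N) * (p.C (B9RWSums347DefiniteFaces.exp261 (@geo9Y θ.d₆ θ.ℓ₆ θ.hd' θ.hL' θ.b₀ θ.b₁ Mstar) p.δ₀ p.α)) + (p.C (B9RWSums347DefiniteFaces.exp261 (@geo9Y θ.d₆ θ.ℓ₆ θ.hd' θ.hL' θ.b₀ θ.b₁ Mstar) p.δ₀ p.α))) + (p.C (B9RWSums347DefiniteFaces.exp261 (@geo9Y θ.d₆ θ.ℓ₆ θ.hd'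 θ.hL' θ.b₀ θ.b₁ Mstar) p.δ₀ p.α)) + B9Thm39ReadingCoords.coordBound39 (trBasis N) * B9Thm39ReadingCoords.basisBound39 (trBasis N) * (p.C (B9RWSums347DefiniteFaces.exp261 (@geo9Y θ.d₆ θ.ℓ₆ θ.hd' θ.hL' θ.b₀ θ.b₁ Mstar) p.δ₀ p.α))) ≤ BhW β') (hδhWle : δhW ≤ ((1 - 2 * p.α) * p.δ₀)) (CP : ℝ)
    (hCPge : ((θ.d₆ + 1 : ℕ) : ℝ) * (coordBound39 (trBasis N) * basisBound39 (trBasis N) * nearBlkCntY θ.d₆ θ.ℓ₆ θ.hd' θ.hL' θ.b₀ θ.b₁ Mstar * ((max 1 (N : ℝ) * ((nbrCountY θ.d₆ θ.ℓ₆ θ.hd' θ.hL' θ.b₀ θ.b₁ 2 : ℝ) * p.C (B9RWSums347DefiniteFaces.exp261 (@geo9Y θ.d₆ θ.ℓ₆ θ.hd' θ.hL' θ.b₀ θ.b₁ Mstar) p.δ₀ p.α) * Real.exp (2 * ((1 - 2 * p.α) * p.δ₀)))) * (cR39 (basis39 (Matrix (Fin N) (Fin N) ℂ)) * Fintype.card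 (κ39 (Matrix (Fin N) (Fin N) ℂ)) * B39 * Real.exp (2 * δ39)) * (max 1 (N : ℝ) * ((nbrCountY θ.d₆ θ.ℓ₆ θ.hd' θ.hL' θ.b₀ θ.b₁ 2 : ℝ) * p.C (B9RWSums347DefiniteFaces.exp261 (@geo9Y θ.d₆ θ.ℓ₆ θ.hd' θ.hL' θ.b₀ θ.b₁ Mstar) p.δ₀ p.α) * Real.exp (2 * ((1 - 2 * p.α) * p.δ₀)))) * cg349 θ.d₆ θ.ℓ₆ θ.hd' θ.hL' θ.b₀ θ.b₁ ((1 - 2 * p.α) * p.δ₀) δ39) * Real.exp (2 * (min ((1 - 2 * p.α) * p.δ₀) δ39 / 8))) ≤ CP) (hBxW : ∀ β', 0 ≤ β' → β' < 1 → (cR39 (trBasis N))⁻¹ * ((wX (sch β'))⁻¹ * B45W β' + BhW β' * (CP * (((θ.ℓ₆ + 1 : ℕ) : ℝ))) * ((wX (sch β'))⁻¹ * ((((θ.ℓ₆ + 1 : ℕ) : ℝ)) * Real.exp ((δFW - αW * δFW - σW) * (rNear θ.d₆ θ.ℓ₆ + 1)))) * rowConst261 (@geo9Y θ.d₆ θ.ℓ₆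 θ.hd' θ.hL' θ.b₀ θ.b₁ Mstar) σW * rowConst261 (@geo9Y θ.d₆ θ.ℓ₆ θ.hd' θ.hL' θ.b₀ θ.b₁ Mstar) σW) ≤ Bx13 β') (hBiYge : ∀ β', 0 ≤ β' → β' < 1 → (((θ.ℓ₆ + 1 : ℕ) : ℝ)) * inputConst45 (exp261 (@geo9Y θ.d₆ θ.ℓ₆ θ.hd' θ.hL' θ.b₀ θ.b₁ Mstar) q.δ₀ q.α) q.δ₀ q.α q.NI q.NF (((θ.ℓ₆ + 1 : ℕ) : ℝ)) (holderConst (exp261 (@geo9Y θ.d₆ θ.ℓ₆ θ.hd' θ.hL' θ.b₀ θ.b₁ Mstar) q.δ₀ q.α) q.δ₀ q.α q.NH q.NF (const37 (exp261 (@geo9Y θ.d₆ θ.ℓ₆ θ.hd' θ.hL' θ.b₀ θ.b₁ Mstar) q.δ₀ q.α) q.δ₀ q.α q.ρ q.B₀ q.Nc q.N' q.Cℓ q.Kc) (q.Bl β') (q.Bt β')) (q.BI2 (sch β' - β') β') (q.θI (sch β')) ≤ BiY β') (hδ45Yle : δ45Y ≤ ((1 - q.αF) * ((1 - 2 * q.α)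 * q.δ₀) - q.α * q.δ₀)) (s44 : ℝ) (hs440 : 0 < s44) (hs441 : s44 < 1) (hws44 : 0 < w13 s44) (δ44 : ℝ) (hδ44 : δ12₃ < δ44) (Bi44 : ℝ) (hBi44 : 0 ≤ Bi44) (hB12₃d : ((θ.d₆ : ℝ) + 1) * ((1 + CLip θ.d₆ θ.ℓ₆) * Bi44 * (CJG θ.d₆ θ.ℓ₆ (trBasis N) s44 (thetaL θ.d₆ θ.ℓ₆ ϑF) (w13 s44) (δ12₃ + 1 + 1 / 2 * (δ44 - δ12₃)) * (((θ.ℓ₆ + 1 : ℕ) : ℝ))) * rowConst261 (@geo9Y θ.d₆ θ.ℓ₆ θ.hd' θ.hL' θ.b₀ θ.b₁ Mstar) 1) ≤ B12₃) (hB12₃p : ((θ.d₆ : ℝ) + 1) * (1 * (((θ.d₆ : ℝ) + 1) * ((1 + CLip θ.d₆ θ.ℓ₆) * Bi44 * (CJG θ.d₆ θ.ℓ₆ (trBasis N) s44 (thetaL θ.d₆ θ.ℓ₆ ϑF) (w13 s44) (δ12₃ + 1 + 1 / 2 * (δ44 - δ12₃)) * (((θ.ℓ₆ + 1 : ℕ)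 : ℝ))) * rowConst261 (@geo9Y θ.d₆ θ.ℓ₆ θ.hd' θ.hL' θ.b₀ θ.b₁ Mstar) 1)) * rowConst261 (@geo9Y θ.d₆ θ.ℓ₆ θ.hd' θ.hL' θ.b₀ θ.b₁ Mstar) 1) ≤ B12₃) (hBi44ge : (((θ.ℓ₆ + 1 : ℕ) : ℝ)) * inputConst44 (exp261 (@geo9Y θ.d₆ θ.ℓ₆ θ.hd' θ.hL' θ.b₀ θ.b₁ Mstar) q.δ₀ q.α) q.δ₀ q.α q.NI q.NF (const37 (exp261 (@geo9Y θ.d₆ θ.ℓ₆ θ.hd' θ.hL' θ.b₀ θ.b₁ Mstar) q.δ₀ q.α) q.δ₀ q.α q.ρ q.B₀ q.Nc q.N' q.Cℓ q.Kc) (((θ.ℓ₆ + 1 : ℕ) : ℝ)) (q.BI s44) (q.θI s44) ≤ Bi44) (hδ44le : δ44 ≤ ((1 - q.αF) * ((1 - 2 * q.α) * q.δ₀) - q.α * q.δ₀)) (hwX44 : 0 < wX s44) (B44G δ44G : ℝ) (hB44G : 0 ≤ B44G) (hδ44G : δFW - αW * δFW - 2 * σW ≤ δ44G) (hB44Gge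 : let Cσ : ℝ := ((((θ.ℓ₆ + 1 : ℕ) : ℝ)) * ((((θ.ℓ₆ + 1 : ℕ) : ℝ)) ^ 3 * (2 + 2 * coordBound39 (trBasis N) * basisBound39 (trBasis N) * (((θ.ℓ₆ + 1 : ℕ) : ℝ)) ^ 2)) * Real.exp ((1 - p.αF) * ((1 - 2 * p.α) * p.δ₀) * (2 * (rNear θ.d₆ θ.ℓ₆ + 1) + (((θ.d₆ : ℝ) + 1) * (((θ.ℓ₆ : ℝ) + 1) + 1) + 2)))); (((θ.ℓ₆ + 1 : ℕ) : ℝ)) * ((((θ.d₆ + 1 : ℕ) : ℝ)) * ((1 + CLip θ.d₆ θ.ℓ₆) * inputConst44 (exp261 (@geo9Y θ.d₆ θ.ℓ₆ θ.hd' θ.hL' θ.b₀ θ.b₁ Mstar) p.δ₀ p.α) p.δ₀ p.α p.NI p.N' (p.C (exp261 (@geo9Y θ.d₆ θ.ℓ₆ θ.hd' θ.hL' θ.b₀ θ.b₁ Mstar) p.δ₀ p.α)) (((θ.ℓ₆ + 1 : ℕ) : ℝ)) (p.BI s44) (p.θI s44) * Cσ * B6.c1 (exp261 (@geo9Y θ.d₆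 θ.ℓ₆ θ.hd' θ.hL' θ.b₀ θ.b₁ Mstar) p.δ₀ p.α) p.δ₀ p.α)) ≤ B44G) (hδ44Gle : δ44G ≤ ((1 - p.αF) * ((1 - 2 * p.α) * p.δ₀) - 3 * (p.α * p.δ₀)))
    (hB₃wG : (cR39 (trBasis N))⁻¹ * ((wX s44)⁻¹ * B44G + (((θ.d₆ + 1 : ℕ) : ℝ) * p.C (B9RWSums347DefiniteFaces.exp261 (@geo9Y θ.d₆ θ.ℓ₆ θ.hd' θ.hL' θ.b₀ θ.b₁ Mstar) p.δ₀ p.α)) * (CP * (((θ.ℓ₆ + 1 : ℕ) : ℝ))) * ((wX s44)⁻¹ * ((((θ.ℓ₆ + 1 : ℕ) : ℝ)) * Real.exp ((δFW - αW * δFW - σW) * (rNear θ.d₆ θ.ℓ₆ + 1)))) * rowConst261 (@geo9Y θ.d₆ θ.ℓ₆ θ.hd' θ.hL' θ.b₀ θ.b₁ Mstar) σW * rowConst261 (@geo9Y θ.d₆ θ.ℓ₆ θ.hd' θ.hL' θ.b₀ θ.b₁ Mstar) σW) ≤ B12₃) (BHG : ℝ) (hBHG : 0 ≤ BHG) (hwBhG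 : ∀ s, 0 < s → s < 1 → wX s * holderConst (exp261 (@geo9Y θ.d₆ θ.ℓ₆ θ.hd' θ.hL' θ.b₀ θ.b₁ Mstar) q.δ₀ q.α) q.δ₀ q.α q.NH q.NF (const37 (exp261 (@geo9Y θ.d₆ θ.ℓ₆ θ.hd' θ.hL' θ.b₀ θ.b₁ Mstar) q.δ₀ q.α) q.δ₀ q.α q.ρ q.B₀ q.Nc q.N' q.Cℓ q.Kc) (q.Bl s) (q.Bt s) ≤ BHG) (B43 δ43 : ℝ) (hB43 : 0 ≤ B43) (B₀D : ℝ) (hB₀D : 0 ≤ B₀D) (hbudD : ∀ s : ℝ, 0 < s → s < 1 → w13 s * ((((θ.d₆ + 1 : ℕ) : ℝ)) * (B9RWSums343Holder.holderConst (B9RWSums347DefiniteFaces.exp261 (@geo9Y θ.d₆ θ.ℓ₆ θ.hd' θ.hL' θ.b₀ θ.b₁ Mstar) p.δ₀ p.α) p.δ₀ p.α p.NH p.N' (p.C (B9RWSums347DefiniteFaces.exp261 (@geo9Y θ.d₆ θ.ℓ₆ θ.hd' θ.hL' θ.b₀ θ.b₁ Mstar) p.δ₀ p.α)) (p.Bl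 s) (p.Bt s) + 2 * B9Thm39ReadingCoords.coordBound39 (trBasis N) * B9Thm39ReadingCoords.basisBound39 (trBasis N) * ((θ.ℓ₆ : ℝ) + 1) * Real.exp (((1 - 2 * p.α) * p.δ₀) * (((θ.d₆ : ℝ) + 1) * (((θ.ℓ₆ : ℝ) + 1) + 1) + 2)) * ((((θ.d₆ + 1 : ℕ) : ℝ)) ^ 2 * (2 * (10 * ((θ.ℓ₆ + 1 : ℕ) : ℝ) * (p.a₁ / c)) * (1 + 10 * ((θ.ℓ₆ + 1 : ℕ) : ℝ) * (p.a₁ / c)) * Real.exp (4 * (10 * ((θ.ℓ₆ + 1 : ℕ) : ℝ) * (p.a₁ / c)))) * ((θ.ℓ₆ + 1 : ℕ) : ℝ) ^ 6) * (p.C (B9RWSums347DefiniteFaces.exp261 (@geo9Y θ.d₆ θ.ℓ₆ θ.hd' θ.hL' θ.b₀ θ.b₁ Mstar) p.δ₀ p.α)) + B9Thm39ReadingCoords.coordBound39 (trBasis N) * B9Thm39ReadingCoords.basisBound39 (trBasis N) * (p.C (B9RWSums347DefiniteFaces.exp261 (@geo9Y θ.d₆ θ.ℓ₆ θ.hd'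 θ.hL' θ.b₀ θ.b₁ Mstar) p.δ₀ p.α)) + (p.C (B9RWSums347DefiniteFaces.exp261 (@geo9Y θ.d₆ θ.ℓ₆ θ.hd' θ.hL' θ.b₀ θ.b₁ Mstar) p.δ₀ p.α)))) ≤ B₀D) (hB43ge : (((θ.ℓ₆ + 1 : ℕ) : ℝ)) * ((((θ.d₆ + 1 : ℕ) : ℝ)) * (p.C (B9RWSums347DefiniteFaces.exp261 (@geo9Y θ.d₆ θ.ℓ₆ θ.hd' θ.hL' θ.b₀ θ.b₁ Mstar) p.δ₀ p.α)) + B₀D) * Real.exp (((1 - 2 * p.α) * p.δ₀) * (rNear θ.d₆ θ.ℓ₆ + 1)) ≤ B43) (hδ43le : δ43 ≤ ((1 - 2 * p.α) * p.δ₀)) (ρrg : ℝ) (hρrg0 : 0 ≤ ρrg) (hbudrg : ρrg + σW + αW * δFW ≤ δFW) (hbud43 : ρrg + σW ≤ δ43) (hδ₃rg : δ12₃ ≤ ρrg) (hB₃rg : B43 * (cR39 (trBasis N))⁻¹ * rowConst261 (@geo9Y θ.d₆ θ.ℓ₆ θ.hd' θ.hL' θ.b₀ θ.b₁ Mstar)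 σW + CTel θ.d₆ θ.ℓ₆ (trBasis N) ρrg (CP * (((θ.ℓ₆ + 1 : ℕ) : ℝ)) * ((((θ.d₆ + 1 : ℕ) : ℝ) * p.C (B9RWSums347DefiniteFaces.exp261 (@geo9Y θ.d₆ θ.ℓ₆ θ.hd' θ.hL' θ.b₀ θ.b₁ Mstar) p.δ₀ p.α)) * (cR39 (trBasis N))⁻¹ * rowConst261 (@geo9Y θ.d₆ θ.ℓ₆ θ.hd' θ.hL' θ.b₀ θ.b₁ Mstar) σW) * rowConst261 (@geo9Y θ.d₆ θ.ℓ₆ θ.hd' θ.hL' θ.b₀ θ.b₁ Mstar) σW) (CP * (((θ.ℓ₆ + 1 : ℕ) : ℝ)) * ((((θ.d₆ + 1 : ℕ) : ℝ) * p.C (B9RWSums347DefiniteFaces.exp261 (@geo9Y θ.d₆ θ.ℓ₆ θ.hd' θ.hL' θ.b₀ θ.b₁ Mstar) p.δ₀ p.α)) * (cR39 (trBasis N))⁻¹ * rowConst261 (@geo9Y θ.d₆ θ.ℓ₆ θ.hd' θ.hL' θ.b₀ θ.b₁ Mstar) σW) * rowConst261 (@geo9Y θ.d₆ θ.ℓ₆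 θ.hd' θ.hL' θ.b₀ θ.b₁ Mstar) σW) ≤ B12₃) (τS δP : ℝ) (hτS : 0 < τS) (hρP12 : ρ12 + 2 * σ12 ≤ δP) (hU8a : δK12 + 3 * σS + 4 * τS ≤ (1 - 2 * p.α) * p.δ₀) (hU8b : δK12 + 3 * σS + 4 * τS ≤ min ((1 - 2 * p.α) * p.δ₀) δ39 / 8) (hU8c : δK12 + 3 * σS + 4 * τS ≤ δ₂) (hU8d : δK12 + 3 * σS + 5 * τS ≤ δ44G) (hU8e : δK12 + 3 * σS + 4 * τS ≤ δB) (hU8f : δK12 + 2 * σS + τS ≤ δ43) (hU8g : δK12 + τS + σS ≤ δT12) (hU8h : δK12 + τS + σS ≤ δ12₃) (hU8i : δK12 + τS + σS ≤ δP) (hU8j : δP + 2 * τS ≤ δ12₀) (hU8k : δP + σS + 2 * τS ≤ δ12₃) (τR : ℝ) (hτR : 0 < τR) (hR8a : δ12₃ + 5 * τR + 3 * σS + 4 * τS ≤ (1 - 2 * p.α) * p.δ₀) (hR8b : δ12₃ + 5 * τR + 3 * σS + 4 * τS ≤ min ((1 - 2 * p.α) * p.δ₀) δ39 / 8) (hR8c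 : δ12₃ + 5 * τR + 3 * σS + 4 * τS ≤ δ₂)
    (hR8d : δ12₃ + 5 * τR + 3 * σS + 5 * τS ≤ δ44G) (hR8e : δ12₃ + 5 * τR + 3 * σS + 4 * τS ≤ δB) (hR8f : δ12₃ + 5 * τR + 2 * σS + τS ≤ δ43) (hR8g : δ12₃ + 5 * τR + τS + σS ≤ δT12) (hR8h : δ12₃ + 5 * τR + 2 * σS + 3 * τS < δ12₀) (hR8i : δ12₃ + 5 * τR + 2 * σS + 3 * τS < δ44) (hR8j : δ12₃ + 5 * τR + 2 * σS + 3 * τS < δ45) (hR8k : δ12₃ + 5 * τR + 2 * σS + 3 * τS < δ45Y) (δQs : ℝ) (hδQs1 : δ12₀ + 1 ≤ δQs) (hδQs2 : δ12₃ + σ12 ≤ δQs) (hδQs3 : δ12₃ + 1 ≤ δQs)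
    -- [«KCX″» ∕ «KD″»] THE Δ⁽²⁾ PRECHAIN's KNIT INPUTS DISPLAYED ((3.137) is DERIVED inside «KD″»; dag-n06-l (L1)/(L2)): c2-form residual reading `h𝔯𝔠`, its (3.36) majorant `hC2` + window `κC δC2`, the G_D-road rate `ρG`, the (3.15) letter of `Q` `hQ15`, `hT16`, `α₀ᴷ ≤ α_Q`, the neighbour floor `hM₀'`
    (κC δC2 : ℝ) (hκC : 0 ≤ κC) (hgap : δ₂ < δC2)
    -- [«KE₄X»] the x-free (3.36)∕Prop-7 window of the c2-form majorant fold (dag-n06-l `c2FormMaj_c2YOfRecord_of_hβ1` at ITS OWN x-free `α₀'` (WA ✓p776410's texts VERBATIM — witnessed by ✓`…NumericsWitnessX`), `a := a12`; `hwKa hwbb hwsmall hwc3 hw145 hw155 hδC2 hκ2` shapes)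
    (α₀' bb : ℝ) (hwKa : 2 * (10 * ((θ.ℓ₆ : ℝ) + 1) * a12) * (1 + 10 * ((θ.ℓ₆ : ℝ) + 1) * a12) * Real.exp (4 * (10 * ((θ.ℓ₆ : ℝ) + 1) * a12)) * ((θ.ℓ₆ : ℝ) + 1) ^ 4 < α₀') (hwα3 : C0 (θ.d₆ + 1) * α₀' ≤ 1 / 3) (hwα4 : 4 * α₀' ≤ c2' (θ.d₆ + 1) (θ.ℓ₆ + 1)) (hwbb : 0 < bb) (hwsmall : Real.exp (4 * (800 * (((θ.d₆ + 1 : ℕ) : ℝ) + 1) ^ 2 * (((θ.d₆ + 1 : ℕ) : ℝ) + 4)) * α₀') * (1 + 8 * (131072 * (((θ.d₆ + 1 : ℕ) : ℝ) + 1) ^ 2) * bb) ≤ 2) (hwc3 : 4 * bb < c3 (θ.d₆ + 1) (θ.ℓ₆ + 1)) (hw145 : 8 * ((θ.d₆ + 1 : ℕ) : ℝ) * thetaGen (θ.d₆ + 1) (θ.ℓ₆ + 1) α₀' * ((θ.ℓ₆ : ℝ) + 1)⁻¹ ^ 4 ≤ 1) (hw155 : (2 * ((θ.ℓ₆ : ℝ)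 + 1) - 1) * ((θ.ℓ₆ : ℝ) + 1)⁻¹ ^ 2 + 2 * ((θ.d₆ + 1 : ℕ) : ℝ) * thetaGen (θ.d₆ + 1) (θ.ℓ₆ + 1) α₀' * ((θ.ℓ₆ : ℝ) + 1)⁻¹ ^ 3 + 1 / 8 * (1 + 2 * ((θ.d₆ + 1 : ℕ) : ℝ) * thetaGen (θ.d₆ + 1) (θ.ℓ₆ + 1) α₀' * ((θ.ℓ₆ : ℝ) + 1)⁻¹ ^ 2 + 2 * ((θ.d₆ + 1 : ℕ) : ℝ) * C3Gen (θ.d₆ + 1) (θ.ℓ₆ + 1) * bb) * ((θ.ℓ₆ : ℝ) + 1)⁻¹ ^ 2 ≤ 1) (hδC2 : 0 ≤ δC2) (hκ2 : C3Gen (θ.d₆ + 1) (θ.ℓ₆ + 1) * Real.exp (2 * δC2 * ((θ.ℓ₆ : ℝ) + 4)) ≤ 2 * κC) (ρG : ℝ) (hρG : 0 < ρG) (hρGP : ρG + σS ≤ δP) (hρGK : ρG + 2 * σS ≤ δK12) (hT16 : (α₀K * (2 * ((θ.d₆ : ℝ) + 1) * kCol (θ.d₆ + 1) (θ.ℓ₆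 + 1) + 8 * ((θ.d₆ : ℝ) + 2) ^ 2)) ^ 2 * (2 * (N : ℝ) * θ.b₁) * (2 * ((θ.d₆ : ℝ) + 1) * Cth θ.d₆) ≤ θ.b₀ / 256) (hαQK : α₀K ≤ alphaQ (θ.d₆ + 1) (θ.ℓ₆ + 1)) (hM₀' : nbrM₀Y θ.d₆ θ.ℓ₆ θ.hd' θ.hL' θ.b₀ θ.b₁ ((θ.ℓ₆ : ℝ) + 4) ≤ Mstar)
    -- [«KC»] the (3.48) display in WA∕KD's spelling (`oneCubeOps39YF … 𝔏 …`; the same row as `h348` above at the record, both `rfl` there) — KD's `h348` input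
    : B9LeafX (Y9OfRecordUPbParHX N θ.toStage3Params Mstar (opsYSectESt N θ.toStage3Params Mstar (opsYS349NuOfLettersH N θ.toStage3Params Mstar (lettersYOfRecordV11K N θ.toStage3Params Mstar (resYOfRecordPK N θ.toStage3Params Mstar)) (fun x => parSymY x.toKIdx) (expsYOfRecordV3Par N θ.toStage3Params Mstar (lettersYOfRecordV11K N θ.toStage3Params Mstar (resYOfRecordPK N θ.toStage3Params Mstar)) 𝔈₀ R₁ R₂ bI (fun x : MemberY θ.d₆ θ.ℓ₆ θ.hd' θ.hL' θ.b₀ θ.b₁ Mstar => parKnitY x.toKIdx) (fun x : MemberY θ.d₆ θ.ℓ₆ θ.hd' θ.hL' θ.b₀ θ.b₁ Mstar => parSymY x.toKIdx) (fun x : MemberY θ.d₆ θ.ℓ₆ θ.hd' θ.hL' θ.b₀ θ.b₁ Mstar => qKnitOfRecord N θ.toStage3Params x.toKIdx) (fun x : MemberY θ.d₆ θ.ℓ₆ θ.hd' θ.hL' θ.b₀ θ.b₁ Mstar => qsKnitOfRecord N θ.toStage3Params x.toKIdx) α' r39 B39 p q p3 q3 pM qM H (fun (x : MemberY θ.d₆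 θ.ℓ₆ θ.hd' θ.hL' θ.b₀ θ.b₁ Mstar) (cc : ↥(cubes x.toKIdx.D.toDomains)) => GpDirY x.toKIdx cc (parKnitY x.toKIdx) (S x cc)) near (fun x : MemberY θ.d₆ θ.ℓ₆ θ.hd' θ.hL' θ.b₀ θ.b₁ Mstar => ops310WalkYO x (trBasis N) (bg9YR (Matrix (Fin N) (Fin N) ℂ) (specialUnitaryUnits (Fin N)) R₁ R₂ x) (fun U => U) (bI x) (lettersYOfRecordV11K N θ.toStage3Params Mstar (resYOfRecordPK N θ.toStage3Params Mstar) x).GA (OcA x) (ΔaA x) (RfA x) (RtA x) (SFA x)) (fun x : MemberY θ.d₆ θ.ℓ₆ θ.hd' θ.hL' θ.b₀ θ.b₁ Mstar => rd310WalkYO x (bg9YR (Matrix (Fin N) (Fin N) ℂ) (specialUnitaryUnits (Fin N)) R₁ R₂ x) (fun U => U) (κ := TrIdx N) (nearA x) (AgreeFA x)) 𝔬12)) (lettersYOfRecordV11K N θ.toStage3Params Mstar (resYOfRecordPK N θ.toStage3Params Mstar)) (sectEStYOfRecordV7 N θ.toStage3Params Mstar 𝔢₀) 𝔴) f bR (fun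 j => C37KY (specialUnitaryUnits (Fin N)) (f j) (ιB j) (fun α₀ U => (bg9YC (Matrix (Fin N) (Fin N) ℂ) (specialUnitaryUnits (Fin N)) (extraYPb (Matrix (Fin N) (Fin N) ℂ) (specialUnitaryUnits (Fin N))) (f j)).Reg335 c35Y α₀ U) (cqY θ.d₆) CqK MK aInv (ϱ' * (((θ.ℓ₆ + 1 : ℕ) : ℝ)) ^ 3 / 3)) C38 (fun j => parKnitY (f j).toKIdx) (fun j => parSymY (f j).toKIdx) (fun j => GAQY (f j).toKIdx (qKnitOfRecord N θ.toStage3Params (f j).toKIdx) (qsKnitOfRecord N θ.toStage3Params (f j).toKIdx) (parKnitY (f j).toKIdx) (GpY (f j).toKIdx (parKnitY (f j).toKIdx))))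
    := by
  exact N06AtOpsYSectEStKnitRecordKE9XA.b9LeafXUR_opsYSectESt_knitRecord_KE9XA (θ := θ) (hθ := hθ) (Mstar := Mstar) (𝔢₀ := 𝔢₀) (𝔴 := 𝔴) (𝔈₀ := 𝔈₀) (R₁ := R₁) (R₂ := R₂) (c := c) (hcB := hcB) (hc := hc) (hGR := hGR) (hRP1 := hRP1) (hP1 := hP1) (hP2 := hP2) (bI := bI) (hbI := hbI) (α' := α') (r39 := r39) (δ39 := δ39) (B39 := B39) (a39 := a39) (hα'0 := hα'0) (hα'1 := hα'1) (hr39 := hr39) (hrδ39 := hrδ39) (hB39 := hB39) (ha39 := ha39) (ha39K := ha39K) (hB39K := hB39K) (hδ39K := hδ39K) (h348n := h348n) (AA := AA) (p := p) (q := q) (hp := hp) (hq := hq) (α₀K := α₀K) (aK := aK) (hαK := hαK) (hαK3 := hαK3) (hαK2 := hαK2) (hKplK := hKplK) (hpaK := hpaK) (hqaK := hqaK) (p3 := p3) (q3 := q3) (hp3 := hp3) (hq3 := hq3) (pM := pM) (qM := qM) (hpM := hpM) (hqM := hqM) (H := H) (hM₀ := hM₀) (𝔭 := 𝔭) (h𝔭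 := h𝔭) (bHX := bHX) (hbHX := hbHX) (SH := SH) (S3 := S3) (SI := SI) (Bc := Bc) (hBc := hBc) (hM₀N := hM₀N) (hB₀ge := hB₀ge) (O := (fun (x : MemberY θ.d₆ θ.ℓ₆ θ.hd' θ.hL' θ.b₀ θ.b₁ Mstar) (cc : ↥(cubes x.toKIdx.D.toDomains)) => GpDirY x.toKIdx cc (parKnitY x.toKIdx) (S x cc))) (near := near) (hnear := hnear) (hOagr := fun x c' U U' h => N06CubeDirInverseAtRecord.hOagr_GpDirY_of_agreeWalkYO x (near x) (S x) (hSnear x) (hSblk x) c' h) (hOsym := fun x α₀ U hU c' => N06CubeDirInverseAtRecord.hOsym_GpDirY_of_unitaryLegs x hGR (S x) (hparU x α₀) hU c') (hOloc := fun x hM α₀ hα ha U hU c' => (N06CubeDirInverseAtRecord.localInverse_laws_hTY_GpDirY x.toKIdx c' (parKnitY x.toKIdx) (hSh x c') (hUnitD x hM α₀ hα ha U hU c')).1) (hOlocT := fun x hM α₀ hα ha U hU c' => (N06CubeDirInverseAtRecord.localInverse_laws_hTY_GpDirY x.toKIdx c' (parKnitY x.toKIdx) (hSh x c') (hUnitD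 x hM α₀ hα ha U hU c')).2) (δM := δM) (hδM := hδM) (hM1L := hM1L) (hδ1L := hδ1L) (hθ1L := hθ1L) (hMixO := hMixO) (hOneO := hOneO) (hmixO := hmixO) (h36b := h36b) (h36H := h36H) (hcntH := hcntH) (hcnt3 := hcnt3) (hcntI := hcntI) (hMw := hMw) (hNMw := hNMw) (hM3 := hM3) (hρ3 := hρ3) (hNc := hNc) (hN' := hN') (hCℓ := hCℓ) (hKc := hKc) (hθ₀ := hθ₀) (OcA := OcA) (ΔaA := ΔaA) (RfA := RfA) (RtA := RtA) (SFA := SFA) (nearA := nearA) (AgreeFA := AgreeFA) (hρ3A := hρ3A) (hNcA := hNcA) (hN'A := hN'A) (hCℓA := hCℓA) (hKcA := hKcA) (hcntFA := hcntFA) (hfacA := hfacA) (hlawsA := hlawsA) (hOagrA := hOagrA) (hRfagrA := hRfagrA) (𝔭A := 𝔭A) (h𝔭A := h𝔭A) (bHXA := bHXA) (SHA := SHA) (S3A := S3A) (SIA := SIA) (SMA := SMA) (hbHXA := hbHXA) (h36HA := h36HA) (hcntHA := hcntHA) (hcnt3A := hcnt3A) (hcntIA := hcntIA) (hcntMA :=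 hcntMA) (BcA := BcA) (hBcA := hBcA) (hB₀geA := hB₀geA) (h36Ab := h36Ab) (𝔬12 := 𝔬12) (h𝔬12 := h𝔬12) (E14₁ := E14₁) (E14₂ := E14₂) (T14₁ := T14₁) (T14₂ := T14₂) (X14₁ := X14₁) (M14₁ := M14₁) (X14₂ := X14₂) (M14₂ := M14₂) (diam14 := diam14) (r14 := r14) (hr14 := hr14) (near14₁ := near14₁) (first14₁ := first14₁) (chain14₁ := chain14₁) (near14₂ := near14₂) (first14₂ := first14₂) (chain14₂ := chain14₂) (h14₁ := h14₁) (h14₂ := h14₂) (W14₁ := W14₁) (W14₂ := W14₂) (hW14₁ := hW14₁) (hW14₂ := hW14₂) (hcnt14₁ := hcnt14₁) (hcnt14₂ := hcnt14₂) (hexp14 := hexp14) (a₀E := a₀E) (δ₁E := δ₁E) (B₁E := B₁E) (ha₀E := ha₀E) (hδ₁E := hδ₁E) (hB₁E := hB₁E) (hE := hE) (J := J) (f := f) (ιR := ιR) (bR := bR) (ιB := ιB) (C38 := C38) (CqK := CqK) (MK := MK) (aInv := aInv) (ϱ' := ϱ') (ha17 := ha17) (hΔAKn := hΔAKn) (hι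 := hι) (hCqK := hCqK) (haInv := haInv) (haIR := haIR) (hα8 := hα8) (hα4N := hα4N) (hαπN := hαπN) (haIK := haIK) (ϱ := ϱ) (hϱ' := hϱ') (hϱ := hϱ) (hsmall' := hsmall') (hc₃' := hc₃') (hϱ'1 := hϱ'1) (hEc := hEc) (hdX := hdX) (hsmall := hsmall) (hc₃ := hc₃) (hM₀K := hM₀K) (hRP2 := hRP2) (hα3 := hα3) (bHXT := bHXT) (hbHXT := hbHXT) (hopI := hopI) (S2A := S2A) (bHXTA := bHXTA) (hbHXTA := hbHXTA) (hopIA := hopIA) (h36A2 := h36A2) (hcnt2A := hcnt2A) (bH13 := bH13) (δ12₀ := δ12₀) (δK12 := δK12) (σ12 := σ12) (ρ12 := ρ12) (a12 := a12) (M12 := M12) (B12₃ := B12₃) (δ12₃ := δ12₃) (ρ13 := ρ13) (α12 := α12) (ρf12 := ρf12) (hρf12 := hρf12) (hρf1 := hρf1) (hρf2 := hρf2) (hB12₃ := hB12₃) (hσ12 := hσ12) (hρ12 := hρ12) (hρS12 := hρS12) (hρδ12 := hρδ12) (hρ₃12 := hρ₃12) (ha12 := ha12) (hαK4 := hαK4)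 (hexpK := hexpK) (hsmallK := hsmallK) (ha12K := ha12K) (hM12 := hM12) (hM12q := hM12q) (hαdK := hαdK) (hα12 := hα12) (hα12' := hα12') (hδ₃₀ := hδ₃₀) (hδ12₀ := hδ12₀) (t12 := t12) (δT12 := δT12) (ρS := ρS) (σS := σS) (ht12 := ht12) (hσS := hσS) (hρST := hρST) (hρS₀ := hρS₀) (hδKS := hδKS) (hσSK := hσSK) (bXH := bXH) (w13 := w13) (wX := wX) (hw13₀ := hw13₀) (hw13₁ := hw13₁) (hwX₀ := hwX₀) (hwX₁ := hwX₁) (hbH13 := hbH13) (hbXH := hbXH) (hρ13 := hρ13) (hρ13ρ := hρ13ρ) (hσρ13 := hσρ13) (B13₄ := B13₄) (Bx13 := Bx13) (hB13₄ := hB13₄) (hBx13 := hBx13) (tJ := tJ) (δB := δB) (rT := rT) (ha1J := ha1J) (htJ := htJ) (hrTP := hrTP) (hrTB := hrTB) (hδT12 := hδT12) (hδTr := hδTr) (ϑF := ϑF) (hϑF := hϑF) (sch := sch) (hsch0 := hsch0) (hsch1 := hsch1) (hschβ := hschβ) (hwsch := hwsch) (δ45 := δ45) (hδ45 := hδ45)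 (BZ := BZ) (hBZ := hBZ) (hBZge := hBZge) (hδ45le := hδ45le) (δ₂ := δ₂) (hrT4 := hrT4) (hrT2 := hrT2) (hδ₃T := hδ₃T) (hδ12₃F := hδ12₃F) (δ45Y := δ45Y) (hδ45Y := hδ45Y) (BiY := BiY) (hBiY := hBiY) (αW := αW) (σW := σW) (δFW := δFW) (hαW0 := hαW0) (hαW1 := hαW1) (hσW := hσW) (hδFW := hδFW) (hδFP := hδFP) (hbudW := hbudW) (hδ3W := hδ3W) (hwschX := hwschX) (δ45W := δ45W) (hδ45W := hδ45W) (B45W := B45W) (hB45W := hB45W) (δhW := δhW) (hδhW := hδhW) (BhW := BhW) (hBhW := hBhW) (hB45Wge := hB45Wge) (hδ45Wle := hδ45Wle) (hBhWge := hBhWge) (hδhWle := hδhWle) (CP := CP) (hCPge := hCPge) (hBxW := hBxW) (hBiYge := hBiYge) (hδ45Yle := hδ45Yle) (s44 := s44) (hs440 := hs440) (hs441 := hs441) (hws44 := hws44) (δ44 := δ44) (hδ44 := hδ44) (Bi44 := Bi44) (hBi44 := hBi44) (hB12₃d := hB12₃d) (hB12₃p := hB12₃p) (hBi44ge := hBi44ge)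 (hδ44le := hδ44le) (hwX44 := hwX44) (B44G := B44G) (δ44G := δ44G) (hB44G := hB44G) (hδ44G := hδ44G) (hB44Gge := hB44Gge) (hδ44Gle := hδ44Gle) (hB₃wG := hB₃wG) (BHG := BHG) (hBHG := hBHG) (hwBhG := hwBhG) (B43 := B43) (δ43 := δ43) (hB43 := hB43) (B₀D := B₀D) (hB₀D := hB₀D) (hbudD := hbudD) (hB43ge := hB43ge) (hδ43le := hδ43le) (ρrg := ρrg) (hρrg0 := hρrg0) (hbudrg := hbudrg) (hbud43 := hbud43) (hδ₃rg := hδ₃rg) (hB₃rg := hB₃rg) (τS := τS) (δP := δP) (hτS := hτS) (hρP12 := hρP12) (hU8a := hU8a) (hU8b := hU8b) (hU8c := hU8c) (hU8d := hU8d) (hU8e := hU8e) (hU8f := hU8f) (hU8g := hU8g) (hU8h := hU8h) (hU8i := hU8i) (hU8j := hU8j) (hU8k := hU8k) (τR := τR) (hτR := hτR) (hR8a := hR8a) (hR8b := hR8b) (hR8c := hR8c) (hR8d := hR8d) (hR8e := hR8e) (hR8f := hR8f) (hR8g := hR8g) (hR8h := hR8h) (hR8i := hR8i) (hR8j := hR8j)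 (hR8k := hR8k) (δQs := δQs) (hδQs1 := hδQs1) (hδQs2 := hδQs2) (hδQs3 := hδQs3) (κC := κC) (δC2 := δC2) (hκC := hκC) (hgap := hgap) (α₀' := α₀') (bb := bb) (hwKa := hwKa) (hwα3 := hwα3) (hwα4 := hwα4) (hwbb := hwbb) (hwsmall := hwsmall) (hwc3 := hwc3) (hw145 := hw145) (hw155 := hw155) (hδC2 := hδC2) (hκ2 := hκ2) (ρG := ρG) (hρG := hρG) (hρGP := hρGP) (hρGK := hρGK) (hT16 := hT16) (hαQK := hαQK) (hM₀' := hM₀')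

end Pointed

end Summit.QuantumFields.YangMills.BalabanUVNodes.N06AtOpsYSectEStKnitRecordKE10XA
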